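import Summits.NavierStokesRegularity.NavierStokesRegularity.Theorems.SqueezeCycleExtremalBiaxialitySubcriticalGaugeStrainBound
import Summits.NavierStokesRegularity.NavierStokesRegularity.Theorems.SqueezeCycleExtremalBiaxialitySubcriticalCubicProductionBound
import Summits.NavierStokesRegularity.NavierStokesRegularity.Theorems.SqueezeCycleExtremalBiaxialitySubcriticalExtremal
import Summits.NavierStokesRegularity.NavierStokesRegularity.Theorems.ExtremalBiaxialitySubcritical.Negative.MaximalityFree
import Summits.NavierStokesRegularity.NavierStokesRegularity.Theorems.SqueezeCycleStrainAlgebra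
import Summits.NavierStokesRegularity.NavierStokesRegularity.Theorems.SqueezeCycleMustSqueezeAlgebra
import Literature.Analysis.FluidPDE.LerayGaugeStrainSpectrum

/-!
# Crux `ExtremalBiaxialitySubcritical` (stmt-NavierStokesRegularity-11609), negative side:
# the open stub pair of line `quarter-bootstrap-pinning` is the route target

Route `SqueezeCycle`, crux
`Summit.NavierStokesRegularity.NavierStokesRegularity.Theses.SqueezeCycle.ExtremalBiaxialitySubcritical`.
The picked line `quarter-bootstrap-pinning` (lead skeleton
`Cruxes/ExtremalBiaxialitySubcritical/Lines/quarter-bootstrap-pinning.lean`) has four stubs; two are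
tree theorems (`stub_gaugeStrainBound`, p72389; `stub_cubicProductionBound`, p72572) and two are open:
`stub_leakyQuarterLawCeiling` — the leaky quarter law in PRODUCTION-CEILING currency ("for `b < 1/4`,
an element of `𝒦_C` with `−4 det S ≤ (2b/(−t))|S|²_F` at every point vanishes") — and
`stub_largeExcessExclusion` ("no element of `𝒦_C` attains a class-wide middle-eigenvalue ceiling `m`
with `1/4 ≤ m − 2m³/K²`, `K` a class-wide gauge strain bound"). This file (refuter, drefute
generation 2, D-0016; extracted from the crux work file `Cruxes/…/Drefute2Attack.lean`) records what
the open pair IS. Every statement spells the two stub signatures out VERBATIM (no local `Prop`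
abbreviations); "the leaky stub on `[0, 1/4)`" is the same text with `0 ≤ b →` inserted.

* `leaky_iff_leakyNonneg` — thresholds `b < 0` are decoration: the leaky stub is equivalent to its
  restriction to `b ∈ [0, 1/4)` (a production ceiling at `b < 0` is one at `0`, `prodCeiling_mono`).
* `msFamily_of_leakyNonneg`, `not_leaky_of_not_mustSqueeze` — the leaky stub implies the sibling
  crux `MustSqueeze` (stmt-NavierStokesRegularity-11610) and its whole family of thresholds `a < 1/4`
  (Λ-ceiling `a ≥ 0` ⇒ production ceiling `a` pointwise, `prodCeiling_of_lerayMiddleStrain_le`, from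
  `neg_det_half_add_transpose_le`); so `¬MustSqueeze` refutes it.
* `largeExcess_iff_forall_le_quarter` — `stub_largeExcessExclusion` is EQUIVALENT to the pointwise
  a-priori bound "`Λ ≤ 1/4` at every point of every element of every `𝒦_C`": the constant `K`, the
  cubic margin `2m³/K²`, the extremal element and the attainment clause are cosmetic (the `∀ K`
  quantification lets `K → ∞` above `stub_gaugeStrainBound`'s constant; `classMax_attained` — the
  proved `ExtremalElementExists` — supplies maximisers).
* `not_stubPair_of_not_crux` (the line's composition re-run over the landed stubs, consuming the
  leaky law only on `[0, 1/4)`), `stubPair_of_squeezeLiouville`, `not_stubPair_of_not_squeezeLiouville`,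
  `not_squeezeLiouville_iff` — **`¬X ⇔ ¬stub_leakyQuarterLawCeiling ∨ ¬stub_largeExcessExclusion`**:
  the open pair is exactly as strong as the route target `SqueezeLiouville`; the line can close the
  crux only by closing X, i.e. the crux AND `MustSqueeze` (cf.
  `Negative.squeezeLiouville_iff_mustSqueeze_and_crux`), and a kill of either stub is a nontrivial
  Type-I ancient element of some `𝒦_C`.
* `largeExcess_and_ne_quarter_of_crux`, `not_crux_iff_of_msFamily` — given only the Λ-family (the
  sibling line's currency), the crux fails iff `stub_largeExcessExclusion` fails or SOME element of
  SOME class takes the value `Λ = 1/4` at SOME point: the production currency of the leaky law and the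
  cubic refinement `b = m − 2m³/K²` buy exactly that single value.
-/

noncomputable section

open MeasureTheory Set Filter Topology
open scoped RealInnerProductSpace Matrix

namespace Summit.NavierStokesRegularity.NavierStokesRegularity.Theorems.ExtremalBiaxialitySubcritical.Negative.QuarterBootstrap

open Literature.Analysis.FluidPDE
open Summit.NavierStokesRegularity.NavierStokesRegularity.Theses
open Summit.NavierStokesRegularity.NavierStokesRegularity.Theorems
open Summit.NavierStokesRegularity.NavierStokesRegularity.Theorems.ExtremalBiaxialitySubcritical.Negative

/-! ### The production ceiling and the leaky stub's thresholds -/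

/-- The pointwise production ceiling `−4 det S(t,x) ≤ (2b/(−t))|S(t,x)|²_F` (the hypothesis of
`stub_leakyQuarterLawCeiling`, verbatim) is monotone in the threshold `b`. [folklore] -/
theorem prodCeiling_mono {b b' : ℝ} (hbb' : b ≤ b') {u : ℝ → (EuclideanSpace ℝ (Fin 3)) → (EuclideanSpace ℝ (Fin 3))}
    (h : ∀ t < 0, ∀ x, -4 * (((1 / 2 : ℝ) • (Literature.Analysis.FluidPDE.stdMatrix (fderiv ℝ (u t) x : EuclideanSpace ℝ (Fin 3) →ₗ[ℝ] EuclideanSpace ℝ (Fin 3)) + (Literature.Analysis.FluidPDE.stdMatrix (fderiv ℝ (u t) x : EuclideanSpace ℝ (Fin 3) →ₗ[ℝ] EuclideanSpace ℝ (Fin 3)))ᵀ))).det ≤ (2 * b / (-t)) * (∑ i, ∑ j, (((1 / 2 : ℝ) • (Literature.Analysis.FluidPDE.stdMatrix (fderiv ℝ (u t) x : EuclideanSpace ℝ (Fin 3) →ₗ[ℝ] EuclideanSpace ℝ (Fin 3)) + (Literature.Analysis.FluidPDE.stdMatrix (fderiv ℝ (u t) x : EuclideanSpace ℝ (Fin 3)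 →ₗ[ℝ] EuclideanSpace ℝ (Fin 3)))ᵀ)) i j) ^ 2)) :
    ∀ t < 0, ∀ x, -4 * (((1 / 2 : ℝ) • (Literature.Analysis.FluidPDE.stdMatrix (fderiv ℝ (u t) x : EuclideanSpace ℝ (Fin 3) →ₗ[ℝ] EuclideanSpace ℝ (Fin 3)) + (Literature.Analysis.FluidPDE.stdMatrix (fderiv ℝ (u t) x : EuclideanSpace ℝ (Fin 3) →ₗ[ℝ] EuclideanSpace ℝ (Fin 3)))ᵀ))).det ≤ (2 * b' / (-t)) * (∑ i, ∑ j, (((1 / 2 : ℝ) • (Literature.Analysis.FluidPDE.stdMatrix (fderiv ℝ (u t) x : EuclideanSpace ℝ (Fin 3) →ₗ[ℝ] EuclideanSpace ℝ (Fin 3)) + (Literature.Analysis.FluidPDE.stdMatrix (fderiv ℝ (u t) x : EuclideanSpace ℝ (Fin 3) →ₗ[ℝ] EuclideanSpace ℝ (Fin 3)))ᵀ)) i j) ^ 2) := by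
  intro t ht x
  refine (h t ht x).trans ?_
  apply mul_le_mul_of_nonneg_right _ (by positivity)
  apply div_le_div_of_nonneg_right _ (neg_pos.2 ht).le
  linarith

/-- **Negative thresholds are decoration**: `stub_leakyQuarterLawCeiling` (left, VERBATIM) is equivalent
to its restriction to thresholds `b ∈ [0, 1/4)` (right). [folklore] -/
theorem leaky_iff_leakyNonneg :
    (∀ (C b : ℝ), b < 1 / 4 → ∀ (u : ℝ → EuclideanSpace ℝ (Fin 3) → EuclideanSpace ℝ (Fin 3)), ContDiffOn ℝ (⊤ : ℕ∞) (Function.uncurry u) (Set.Iio 0 ×ˢ Set.univ) ∧ (∀ t < 0, Literature.Analysis.FluidPDE.VectorCalculus.IsDivFree (u t)) ∧ (∀ s t : ℝ, s < t → t < 0 → ∀ x, u t x = Literature.Analysis.FluidPDE.heatFlow (u s) (t-s) x - ∫ τ in Set.Ioo s t, ∫ y, ((-(inner ℝ (x-y) (u τ y) / (2*(t-τ)) * Literature.Analysis.UnboundedOperators.heatKernel (t-τ) (x-y))) • u τ y + (∫ σ in Set.Ioi (t-τ), Literature.Analysis.UnboundedOperators.heatKernel σ (x-y) / (4*σ^2))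 • (inner ℝ (x-y) (u τ y) • u τ y + inner ℝ (u τ y) (u τ y) • (x-y) + inner ℝ (x-y) (u τ y) • u τ y) - ((∫ σ in Set.Ioi (t-τ), Literature.Analysis.UnboundedOperators.heatKernel σ (x-y) / (8*σ^3)) * (inner ℝ (x-y) (u τ y) * inner ℝ (x-y) (u τ y))) • (x-y))) ∧ Literature.Analysis.FluidPDE.HasTypeITimeDecay C u ∧ (∀ (x₀ : EuclideanSpace ℝ (Fin 3)) (t₀ r : ℝ), t₀ ≤ 0 → 0 < r → (∀ t, t₀ - r^2 < t → t < t₀ → r⁻¹ * ∫ x in Metric.ball x₀ r, ‖u t x‖^2 ≤ C) ∧ r⁻¹ * ∫ t in Set.Ioo (t₀ - r^2) t₀, ∫ x in Metric.ball x₀ r, ‖fderiv ℝ (u t) x‖^2 ≤ C) → (∀ t < 0, ∀ x, -4 * (((1 / 2 : ℝ) • (Literature.Analysis.FluidPDE.stdMatrix (fderiv ℝ (u t) x : EuclideanSpace ℝ (Fin 3) →ₗ[ℝ] EuclideanSpace ℝ (Fin 3)) + (Literature.Analysis.FluidPDE.stdMatrix (fderiv ℝ (u t) x : EuclideanSpace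 ℝ (Fin 3) →ₗ[ℝ] EuclideanSpace ℝ (Fin 3)))ᵀ))).det ≤ (2 * b / (-t)) * (∑ i, ∑ j, (((1 / 2 : ℝ) • (Literature.Analysis.FluidPDE.stdMatrix (fderiv ℝ (u t) x : EuclideanSpace ℝ (Fin 3) →ₗ[ℝ] EuclideanSpace ℝ (Fin 3)) + (Literature.Analysis.FluidPDE.stdMatrix (fderiv ℝ (u t) x : EuclideanSpace ℝ (Fin 3) →ₗ[ℝ] EuclideanSpace ℝ (Fin 3)))ᵀ)) i j) ^ 2)) → ∀ t < 0, ∀ x, u t x = 0) ↔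
      (∀ (C b : ℝ), 0 ≤ b → b < 1 / 4 → ∀ (u : ℝ → EuclideanSpace ℝ (Fin 3) → EuclideanSpace ℝ (Fin 3)), ContDiffOn ℝ (⊤ : ℕ∞) (Function.uncurry u) (Set.Iio 0 ×ˢ Set.univ) ∧ (∀ t < 0, Literature.Analysis.FluidPDE.VectorCalculus.IsDivFree (u t)) ∧ (∀ s t : ℝ, s < t → t < 0 → ∀ x, u t x = Literature.Analysis.FluidPDE.heatFlow (u s) (t-s) x - ∫ τ in Set.Ioo s t, ∫ y, ((-(inner ℝ (x-y) (u τ y) / (2*(t-τ)) * Literature.Analysis.UnboundedOperators.heatKernel (t-τ) (x-y))) • u τ y + (∫ σ in Set.Ioi (t-τ), Literature.Analysis.UnboundedOperators.heatKernel σ (x-y) / (4*σ^2)) • (inner ℝ (x-y) (u τ y) • u τ y + inner ℝ (u τ y) (u τ y) • (x-y) + inner ℝ (x-y) (u τ y) • u τ y) - ((∫ σ in Set.Ioi (t-τ), Literature.Analysis.UnboundedOperators.heatKernel σ (x-y) / (8*σ^3)) * (inner ℝ (x-y) (u τ y) * inner ℝ (x-y) (u τ y))) • (x-y))) ∧ Literature.Analysis.FluidPDE.HasTypeITimeDecay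 C u ∧ (∀ (x₀ : EuclideanSpace ℝ (Fin 3)) (t₀ r : ℝ), t₀ ≤ 0 → 0 < r → (∀ t, t₀ - r^2 < t → t < t₀ → r⁻¹ * ∫ x in Metric.ball x₀ r, ‖u t x‖^2 ≤ C) ∧ r⁻¹ * ∫ t in Set.Ioo (t₀ - r^2) t₀, ∫ x in Metric.ball x₀ r, ‖fderiv ℝ (u t) x‖^2 ≤ C) → (∀ t < 0, ∀ x, -4 * (((1 / 2 : ℝ) • (Literature.Analysis.FluidPDE.stdMatrix (fderiv ℝ (u t) x : EuclideanSpace ℝ (Fin 3) →ₗ[ℝ] EuclideanSpace ℝ (Fin 3)) + (Literature.Analysis.FluidPDE.stdMatrix (fderiv ℝ (u t) x : EuclideanSpace ℝ (Fin 3) →ₗ[ℝ] EuclideanSpace ℝ (Fin 3)))ᵀ))).det ≤ (2 * b / (-t)) * (∑ i, ∑ j, (((1 / 2 : ℝ) • (Literature.Analysis.FluidPDE.stdMatrix (fderiv ℝ (u t) x : EuclideanSpace ℝ (Fin 3) →ₗ[ℝ] EuclideanSpace ℝ (Fin 3)) + (Literature.Analysis.FluidPDE.stdMatrix (fderiv ℝ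 (u t) x : EuclideanSpace ℝ (Fin 3) →ₗ[ℝ] EuclideanSpace ℝ (Fin 3)))ᵀ)) i j) ^ 2)) → ∀ t < 0, ∀ x, u t x = 0) := by
  refine ⟨fun h C b _ hb u hu hc => h C b hb u hu hc, fun h C b hb u hu hc => ?_⟩
  rcases le_or_gt 0 b with hb0 | hb0
  · exact h C b hb0 hb u hu hc
  · exact h C 0 le_rfl (by norm_num) u hu (prodCeiling_mono hb0.le hc)

/-- **Λ-ceiling ⇒ production ceiling at the same threshold `a ≥ 0`**, pointwise on divergence-free
slices (Miller's `−4 det S ≤ 2λ₂⁺|S|²`, tree `neg_det_half_add_transpose_le`). [folklore] -/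
theorem prodCeiling_of_lerayMiddleStrain_le {u : ℝ → (EuclideanSpace ℝ (Fin 3)) → (EuclideanSpace ℝ (Fin 3))} {a : ℝ} (ha : 0 ≤ a)
    (hdiv : ∀ t < 0, VectorCalculus.IsDivFree (u t))
    (hΛ : ∀ t < 0, ∀ x, lerayMiddleStrain u t x ≤ a) :
    ∀ t < 0, ∀ x, -4 * (((1 / 2 : ℝ) • (Literature.Analysis.FluidPDE.stdMatrix (fderiv ℝ (u t) x : EuclideanSpace ℝ (Fin 3) →ₗ[ℝ] EuclideanSpace ℝ (Fin 3)) + (Literature.Analysis.FluidPDE.stdMatrix (fderiv ℝ (u t) x : EuclideanSpace ℝ (Fin 3) →ₗ[ℝ] EuclideanSpace ℝ (Fin 3)))ᵀ))).det ≤ (2 * a / (-t)) * (∑ i, ∑ j, (((1 / 2 : ℝ) • (Literature.Analysis.FluidPDE.stdMatrix (fderiv ℝ (u t) x : EuclideanSpace ℝ (Fin 3) →ₗ[ℝ] EuclideanSpace ℝ (Fin 3)) + (Literature.Analysis.FluidPDE.stdMatrix (fderiv ℝ (u t) x : EuclideanSpace ℝ (Fin 3) →ₗ[ℝ] EuclideanSpace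 ℝ (Fin 3)))ᵀ)) i j) ^ 2) := by
  intro t ht x
  have ht' : 0 < -t := neg_pos.2 ht
  set M := Literature.Analysis.FluidPDE.stdMatrix (fderiv ℝ (u t) x : (EuclideanSpace ℝ (Fin 3)) →ₗ[ℝ] (EuclideanSpace ℝ (Fin 3))) with hM
  have htr : M.trace = 0 := by rw [hM, trace_stdMatrix]; exact hdiv t ht x
  have hμ : (Matrix.isHermitian_add_transpose_self M).eigenvalues₀ 1 ≤ 2 * (a / (-t)) := by
    have h1 := hΛ t ht x
    rw [lerayMiddleStrain_eq_eigenvalues₀] at h1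
    rw [mul_div_assoc', le_div_iff₀ ht']
    nlinarith
  have key := neg_det_half_add_transpose_le M htr (div_nonneg ha ht'.le) hμ
  have e : 2 * (a / (-t)) = 2 * a / (-t) := mul_div_assoc' 2 a (-t)
  rw [e] at key
  exact key

/-- **The leaky stub on `[0, 1/4)` implies the whole `MustSqueeze` family below `1/4`** (conclusion:
VERBATIM the hypothesis `hMS` of `extremalBiaxialitySubcritical_bootstrap`). [folklore] -/
theorem msFamily_of_leakyNonneg
    (hL : ∀ (C b : ℝ), 0 ≤ b → b < 1 / 4 → ∀ (u : ℝ → EuclideanSpace ℝ (Fin 3) → EuclideanSpace ℝ (Fin 3)), ContDiffOn ℝ (⊤ : ℕ∞) (Function.uncurry u) (Set.Iio 0 ×ˢ Set.univ) ∧ (∀ t < 0, Literature.Analysis.FluidPDE.VectorCalculus.IsDivFree (u t)) ∧ (∀ s t : ℝ, s < t → t < 0 → ∀ x, u t x = Literature.Analysis.FluidPDE.heatFlow (u s) (t-s) x - ∫ τ in Set.Ioo s t, ∫ y, ((-(inner ℝ (x-y) (u τ y) / (2*(t-τ)) * Literature.Analysis.UnboundedOperators.heatKernel (t-τ) (x-y)))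 • u τ y + (∫ σ in Set.Ioi (t-τ), Literature.Analysis.UnboundedOperators.heatKernel σ (x-y) / (4*σ^2)) • (inner ℝ (x-y) (u τ y) • u τ y + inner ℝ (u τ y) (u τ y) • (x-y) + inner ℝ (x-y) (u τ y) • u τ y) - ((∫ σ in Set.Ioi (t-τ), Literature.Analysis.UnboundedOperators.heatKernel σ (x-y) / (8*σ^3)) * (inner ℝ (x-y) (u τ y) * inner ℝ (x-y) (u τ y))) • (x-y))) ∧ Literature.Analysis.FluidPDE.HasTypeITimeDecay C u ∧ (∀ (x₀ : EuclideanSpace ℝ (Fin 3)) (t₀ r : ℝ), t₀ ≤ 0 → 0 < r → (∀ t, t₀ - r^2 < t → t < t₀ → r⁻¹ * ∫ x in Metric.ball x₀ r, ‖u t x‖^2 ≤ C) ∧ r⁻¹ * ∫ t in Set.Ioo (t₀ - r^2) t₀, ∫ x in Metric.ball x₀ r, ‖fderiv ℝ (u t) x‖^2 ≤ C) → (∀ t < 0, ∀ x, -4 * (((1 / 2 : ℝ) • (Literature.Analysis.FluidPDE.stdMatrix (fderiv ℝ (u t) x : EuclideanSpace ℝ (Fin 3) →ₗ[ℝ] EuclideanSpace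 ℝ (Fin 3)) + (Literature.Analysis.FluidPDE.stdMatrix (fderiv ℝ (u t) x : EuclideanSpace ℝ (Fin 3) →ₗ[ℝ] EuclideanSpace ℝ (Fin 3)))ᵀ))).det ≤ (2 * b / (-t)) * (∑ i, ∑ j, (((1 / 2 : ℝ) • (Literature.Analysis.FluidPDE.stdMatrix (fderiv ℝ (u t) x : EuclideanSpace ℝ (Fin 3) →ₗ[ℝ] EuclideanSpace ℝ (Fin 3)) + (Literature.Analysis.FluidPDE.stdMatrix (fderiv ℝ (u t) x : EuclideanSpace ℝ (Fin 3) →ₗ[ℝ] EuclideanSpace ℝ (Fin 3)))ᵀ)) i j) ^ 2)) → ∀ t < 0, ∀ x, u t x = 0) :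
    ∀ a : ℝ, a < 1 / 4 → ∀ (C : ℝ) (u : ℝ → EuclideanSpace ℝ (Fin 3) → EuclideanSpace ℝ (Fin 3)), ContDiffOn ℝ (⊤ : ℕ∞) (Function.uncurry u) (Set.Iio 0 ×ˢ Set.univ) ∧ (∀ t < 0, Literature.Analysis.FluidPDE.VectorCalculus.IsDivFree (u t)) ∧ (∀ s t : ℝ, s < t → t < 0 → ∀ x, u t x = Literature.Analysis.FluidPDE.heatFlow (u s) (t-s) x - ∫ τ in Set.Ioo s t, ∫ y, ((-(inner ℝ (x-y) (u τ y) / (2*(t-τ)) * Literature.Analysis.UnboundedOperators.heatKernel (t-τ) (x-y))) • u τ y + (∫ σ in Set.Ioi (t-τ), Literature.Analysis.UnboundedOperators.heatKernel σ (x-y) / (4*σ^2)) • (inner ℝ (x-y) (u τ y) • u τ y + inner ℝ (u τ y) (u τ y) • (x-y) + inner ℝ (x-y) (u τ y) • u τ y) - ((∫ σ in Set.Ioi (t-τ), Literature.Analysis.UnboundedOperators.heatKernel σ (x-y) / (8*σ^3)) * (inner ℝ (x-y) (u τ y) * inner ℝ (x-y) (u τ y))) • (x-y))) ∧ Literature.Analysis.FluidPDE.HasTypeITimeDecay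 C u ∧ (∀ (x₀ : EuclideanSpace ℝ (Fin 3)) (t₀ r : ℝ), t₀ ≤ 0 → 0 < r → (∀ t, t₀ - r^2 < t → t < t₀ → r⁻¹ * ∫ x in Metric.ball x₀ r, ‖u t x‖^2 ≤ C) ∧ r⁻¹ * ∫ t in Set.Ioo (t₀ - r^2) t₀, ∫ x in Metric.ball x₀ r, ‖fderiv ℝ (u t) x‖^2 ≤ C) → (∀ t < 0, ∀ x, (∃ v w : EuclideanSpace ℝ (Fin 3), ‖v‖ = 1 ∧ ‖w‖ = 1 ∧ inner ℝ v w = 0 ∧ ∀ α β : ℝ, (-t) * inner ℝ (fderiv ℝ (u t) x (α • v + β • w)) (α • v + β • w) ≤ a * (α^2 + β^2))) → ∀ t < 0, ∀ x, u t x = 0 := by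
  intro a ha C u hu hΛ
  have ha0 : 0 ≤ max a 0 := le_max_right _ _
  have ha4 : max a 0 < 1 / 4 := max_lt ha (by norm_num)
  have hΛ' : ∀ t < 0, ∀ x, lerayMiddleStrain u t x ≤ max a 0 := fun t ht x =>
    ((lerayMiddleStrain_le_iff ht a).2 (hΛ t ht x)).trans (le_max_left _ _)
  exact hL C (max a 0) ha0 ha4 u hu (prodCeiling_of_lerayMiddleStrain_le ha0 hu.2.1 hΛ')

/-- Hence **a refutation of the sibling crux `MustSqueeze` refutes `stub_leakyQuarterLawCeiling`**
(VERBATIM). [folklore] -/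
theorem not_leaky_of_not_mustSqueeze (hM : ¬ SqueezeCycle.MustSqueeze) :
    ¬ (∀ (C b : ℝ), b < 1 / 4 → ∀ (u : ℝ → EuclideanSpace ℝ (Fin 3) → EuclideanSpace ℝ (Fin 3)), ContDiffOn ℝ (⊤ : ℕ∞) (Function.uncurry u) (Set.Iio 0 ×ˢ Set.univ) ∧ (∀ t < 0, Literature.Analysis.FluidPDE.VectorCalculus.IsDivFree (u t)) ∧ (∀ s t : ℝ, s < t → t < 0 → ∀ x, u t x = Literature.Analysis.FluidPDE.heatFlow (u s) (t-s) x - ∫ τ in Set.Ioo s t, ∫ y, ((-(inner ℝ (x-y) (u τ y) / (2*(t-τ)) * Literature.Analysis.UnboundedOperators.heatKernel (t-τ) (x-y))) • u τ y + (∫ σ in Set.Ioi (t-τ), Literature.Analysis.UnboundedOperators.heatKernel σ (x-y) / (4*σ^2)) • (inner ℝ (x-y) (u τ y) • u τ y + inner ℝ (u τ y) (u τ y) • (x-y) + inner ℝ (x-y) (u τ y) • u τ y) - ((∫ σ in Set.Ioi (t-τ), Literature.Analysis.UnboundedOperators.heatKernel σ (x-y) / (8*σ^3)) * (inner ℝ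 (x-y) (u τ y) * inner ℝ (x-y) (u τ y))) • (x-y))) ∧ Literature.Analysis.FluidPDE.HasTypeITimeDecay C u ∧ (∀ (x₀ : EuclideanSpace ℝ (Fin 3)) (t₀ r : ℝ), t₀ ≤ 0 → 0 < r → (∀ t, t₀ - r^2 < t → t < t₀ → r⁻¹ * ∫ x in Metric.ball x₀ r, ‖u t x‖^2 ≤ C) ∧ r⁻¹ * ∫ t in Set.Ioo (t₀ - r^2) t₀, ∫ x in Metric.ball x₀ r, ‖fderiv ℝ (u t) x‖^2 ≤ C) → (∀ t < 0, ∀ x, -4 * (((1 / 2 : ℝ) • (Literature.Analysis.FluidPDE.stdMatrix (fderiv ℝ (u t) x : EuclideanSpace ℝ (Fin 3) →ₗ[ℝ] EuclideanSpace ℝ (Fin 3)) + (Literature.Analysis.FluidPDE.stdMatrix (fderiv ℝ (u t) x : EuclideanSpace ℝ (Fin 3) →ₗ[ℝ] EuclideanSpace ℝ (Fin 3)))ᵀ))).det ≤ (2 * b / (-t)) * (∑ i, ∑ j, (((1 / 2 : ℝ) • (Literature.Analysis.FluidPDE.stdMatrix (fderiv ℝ (u t) x : EuclideanSpace ℝ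 (Fin 3) →ₗ[ℝ] EuclideanSpace ℝ (Fin 3)) + (Literature.Analysis.FluidPDE.stdMatrix (fderiv ℝ (u t) x : EuclideanSpace ℝ (Fin 3) →ₗ[ℝ] EuclideanSpace ℝ (Fin 3)))ᵀ)) i j) ^ 2)) → ∀ t < 0, ∀ x, u t x = 0) :=
  fun hL => hM (msFamily_of_leakyNonneg (leaky_iff_leakyNonneg.1 hL) (1 / 8) (by norm_num))

/-! ### The large-excess stub is the pointwise quarter bound -/

/-- **crux ⇒ `stub_largeExcessExclusion`** (VERBATIM): the stub is the crux on its regime. [folklore] -/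
theorem largeExcess_of_crux (hX : SqueezeCycle.ExtremalBiaxialitySubcritical) :
    ∀ (C K m : ℝ) (u : ℝ → EuclideanSpace ℝ (Fin 3) → EuclideanSpace ℝ (Fin 3)) (t₀ : ℝ) (x₀ : EuclideanSpace ℝ (Fin 3)), 0 < K → (∀ (v' : ℝ → EuclideanSpace ℝ (Fin 3) → EuclideanSpace ℝ (Fin 3)), ContDiffOn ℝ (⊤ : ℕ∞) (Function.uncurry v') (Set.Iio 0 ×ˢ Set.univ) ∧ (∀ t < 0, Literature.Analysis.FluidPDE.VectorCalculus.IsDivFree (v' t)) ∧ (∀ s t : ℝ, s < t → t < 0 → ∀ x, v' t x = Literature.Analysis.FluidPDE.heatFlow (v' s) (t-s) x - ∫ τ in Set.Ioo s t, ∫ y, ((-(inner ℝ (x-y) (v' τ y) / (2*(t-τ)) * Literature.Analysis.UnboundedOperators.heatKernel (t-τ) (x-y))) • v' τ y + (∫ σ in Set.Ioi (t-τ), Literature.Analysis.UnboundedOperators.heatKernel σ (x-y) / (4*σ^2)) • (inner ℝ (x-y) (v' τ y) • v' τ y + inner ℝ (v' τ y) (v' τ y) • (x-y) + inner ℝ (x-y)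 (v' τ y) • v' τ y) - ((∫ σ in Set.Ioi (t-τ), Literature.Analysis.UnboundedOperators.heatKernel σ (x-y) / (8*σ^3)) * (inner ℝ (x-y) (v' τ y) * inner ℝ (x-y) (v' τ y))) • (x-y))) ∧ Literature.Analysis.FluidPDE.HasTypeITimeDecay C v' ∧ (∀ (x₀ : EuclideanSpace ℝ (Fin 3)) (t₀ r : ℝ), t₀ ≤ 0 → 0 < r → (∀ t, t₀ - r^2 < t → t < t₀ → r⁻¹ * ∫ x in Metric.ball x₀ r, ‖v' t x‖^2 ≤ C) ∧ r⁻¹ * ∫ t in Set.Ioo (t₀ - r^2) t₀, ∫ x in Metric.ball x₀ r, ‖fderiv ℝ (v' t) x‖^2 ≤ C) → ∀ t < 0, ∀ x, (∑ i, ∑ j, (((1 / 2 : ℝ) • (Literature.Analysis.FluidPDE.stdMatrix (fderiv ℝ (v' t) x : EuclideanSpace ℝ (Fin 3) →ₗ[ℝ] EuclideanSpace ℝ (Fin 3)) + (Literature.Analysis.FluidPDE.stdMatrix (fderiv ℝ (v' t) x : EuclideanSpace ℝ (Fin 3) →ₗ[ℝ] EuclideanSpace ℝ (Fin 3)))ᵀ))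 i j) ^ 2) ≤ (K / (-t)) ^ 2 ∧ Literature.Analysis.FluidPDE.lerayMiddleStrain v' t x ≤ m) → 0 ≤ m → 1 / 4 ≤ m - 2 * m ^ 3 / K ^ 2 → t₀ < 0 → (ContDiffOn ℝ (⊤ : ℕ∞) (Function.uncurry u) (Set.Iio 0 ×ˢ Set.univ) ∧ (∀ t < 0, Literature.Analysis.FluidPDE.VectorCalculus.IsDivFree (u t)) ∧ (∀ s t : ℝ, s < t → t < 0 → ∀ x, u t x = Literature.Analysis.FluidPDE.heatFlow (u s) (t-s) x - ∫ τ in Set.Ioo s t, ∫ y, ((-(inner ℝ (x-y) (u τ y) / (2*(t-τ)) * Literature.Analysis.UnboundedOperators.heatKernel (t-τ) (x-y))) • u τ y + (∫ σ in Set.Ioi (t-τ), Literature.Analysis.UnboundedOperators.heatKernel σ (x-y) / (4*σ^2)) • (inner ℝ (x-y) (u τ y) • u τ y + inner ℝ (u τ y) (u τ y) • (x-y) + inner ℝ (x-y) (u τ y) • u τ y) - ((∫ σ in Set.Ioi (t-τ), Literature.Analysis.UnboundedOperators.heatKernel σ (x-y) / (8*σ^3)) * (inner ℝ (x-y) (u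 τ y) * inner ℝ (x-y) (u τ y))) • (x-y))) ∧ Literature.Analysis.FluidPDE.HasTypeITimeDecay C u ∧ (∀ (x₀ : EuclideanSpace ℝ (Fin 3)) (t₀ r : ℝ), t₀ ≤ 0 → 0 < r → (∀ t, t₀ - r^2 < t → t < t₀ → r⁻¹ * ∫ x in Metric.ball x₀ r, ‖u t x‖^2 ≤ C) ∧ r⁻¹ * ∫ t in Set.Ioo (t₀ - r^2) t₀, ∫ x in Metric.ball x₀ r, ‖fderiv ℝ (u t) x‖^2 ≤ C)) → m ≤ Literature.Analysis.FluidPDE.lerayMiddleStrain u t₀ x₀ → False := by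
  intro C K m u t₀ x₀ hK hcls hm0 hreg ht₀ hu hatt
  have h8 : m < 1 / 8 := hX C m u t₀ x₀ ht₀ hu ((le_lerayMiddleStrain_iff ht₀ m).1 hatt)
    (fun v' hv' t ht x => (lerayMiddleStrain_le_iff ht m).1 (hcls v' hv' t ht x).2)
  have h3 : 0 ≤ 2 * m ^ 3 / K ^ 2 := by positivity
  linarith

/-- **`stub_largeExcessExclusion` (VERBATIM) ⇔ "Λ ≤ 1/4 at every point of every element of every 𝒦_C"**
— no hypothesis: `K`, the cubic margin, the extremal element and the attainment clause are cosmetic.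
(⇒: a point with `Λ > 1/4` gives by `classMax_attained` an attained class maximum `m > 1/4`; inflate
the constant of `stub_gaugeStrainBound` until `1/4 ≤ m − 2m³/K²`. ⇐: attainment gives `m ≤ 1/4`, and
`1/4 ≤ m − 2m³/K²`, `m ≥ 0` is then absurd.) [folklore] -/
theorem largeExcess_iff_forall_le_quarter :
    (∀ (C K m : ℝ) (u : ℝ → EuclideanSpace ℝ (Fin 3) → EuclideanSpace ℝ (Fin 3)) (t₀ : ℝ) (x₀ : EuclideanSpace ℝ (Fin 3)), 0 < K → (∀ (v' : ℝ → EuclideanSpace ℝ (Fin 3) → EuclideanSpace ℝ (Fin 3)), ContDiffOn ℝ (⊤ : ℕ∞) (Function.uncurry v') (Set.Iio 0 ×ˢ Set.univ) ∧ (∀ t < 0, Literature.Analysis.FluidPDE.VectorCalculus.IsDivFree (v' t)) ∧ (∀ s t : ℝ, s < t → t < 0 → ∀ x, v' t x = Literature.Analysis.FluidPDE.heatFlow (v' s) (t-s) x - ∫ τ in Set.Ioo s t, ∫ y, ((-(inner ℝ (x-y) (v' τ y) / (2*(t-τ)) * Literature.Analysis.UnboundedOperators.heatKernel (t-τ) (x-y)))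 • v' τ y + (∫ σ in Set.Ioi (t-τ), Literature.Analysis.UnboundedOperators.heatKernel σ (x-y) / (4*σ^2)) • (inner ℝ (x-y) (v' τ y) • v' τ y + inner ℝ (v' τ y) (v' τ y) • (x-y) + inner ℝ (x-y) (v' τ y) • v' τ y) - ((∫ σ in Set.Ioi (t-τ), Literature.Analysis.UnboundedOperators.heatKernel σ (x-y) / (8*σ^3)) * (inner ℝ (x-y) (v' τ y) * inner ℝ (x-y) (v' τ y))) • (x-y))) ∧ Literature.Analysis.FluidPDE.HasTypeITimeDecay C v' ∧ (∀ (x₀ : EuclideanSpace ℝ (Fin 3)) (t₀ r : ℝ), t₀ ≤ 0 → 0 < r → (∀ t, t₀ - r^2 < t → t < t₀ → r⁻¹ * ∫ x in Metric.ball x₀ r, ‖v' t x‖^2 ≤ C) ∧ r⁻¹ * ∫ t in Set.Ioo (t₀ - r^2) t₀, ∫ x in Metric.ball x₀ r, ‖fderiv ℝ (v' t) x‖^2 ≤ C) → ∀ t < 0, ∀ x, (∑ i, ∑ j, (((1 / 2 : ℝ) • (Literature.Analysis.FluidPDE.stdMatrix (fderiv ℝ (v' t) x : EuclideanSpace ℝ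 (Fin 3) →ₗ[ℝ] EuclideanSpace ℝ (Fin 3)) + (Literature.Analysis.FluidPDE.stdMatrix (fderiv ℝ (v' t) x : EuclideanSpace ℝ (Fin 3) →ₗ[ℝ] EuclideanSpace ℝ (Fin 3)))ᵀ)) i j) ^ 2) ≤ (K / (-t)) ^ 2 ∧ Literature.Analysis.FluidPDE.lerayMiddleStrain v' t x ≤ m) → 0 ≤ m → 1 / 4 ≤ m - 2 * m ^ 3 / K ^ 2 → t₀ < 0 → (ContDiffOn ℝ (⊤ : ℕ∞) (Function.uncurry u) (Set.Iio 0 ×ˢ Set.univ) ∧ (∀ t < 0, Literature.Analysis.FluidPDE.VectorCalculus.IsDivFree (u t)) ∧ (∀ s t : ℝ, s < t → t < 0 → ∀ x, u t x = Literature.Analysis.FluidPDE.heatFlow (u s) (t-s) x - ∫ τ in Set.Ioo s t, ∫ y, ((-(inner ℝ (x-y) (u τ y) / (2*(t-τ)) * Literature.Analysis.UnboundedOperators.heatKernel (t-τ) (x-y))) • u τ y + (∫ σ in Set.Ioi (t-τ), Literature.Analysis.UnboundedOperators.heatKernel σ (x-y) / (4*σ^2)) • (inner ℝ (x-y) (u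 τ y) • u τ y + inner ℝ (u τ y) (u τ y) • (x-y) + inner ℝ (x-y) (u τ y) • u τ y) - ((∫ σ in Set.Ioi (t-τ), Literature.Analysis.UnboundedOperators.heatKernel σ (x-y) / (8*σ^3)) * (inner ℝ (x-y) (u τ y) * inner ℝ (x-y) (u τ y))) • (x-y))) ∧ Literature.Analysis.FluidPDE.HasTypeITimeDecay C u ∧ (∀ (x₀ : EuclideanSpace ℝ (Fin 3)) (t₀ r : ℝ), t₀ ≤ 0 → 0 < r → (∀ t, t₀ - r^2 < t → t < t₀ → r⁻¹ * ∫ x in Metric.ball x₀ r, ‖u t x‖^2 ≤ C) ∧ r⁻¹ * ∫ t in Set.Ioo (t₀ - r^2) t₀, ∫ x in Metric.ball x₀ r, ‖fderiv ℝ (u t) x‖^2 ≤ C)) → m ≤ Literature.Analysis.FluidPDE.lerayMiddleStrain u t₀ x₀ → False) ↔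
      ∀ (C : ℝ) (u : ℝ → EuclideanSpace ℝ (Fin 3) → EuclideanSpace ℝ (Fin 3)), (ContDiffOn ℝ (⊤ : ℕ∞) (Function.uncurry u) (Set.Iio 0 ×ˢ Set.univ) ∧ (∀ t < 0, Literature.Analysis.FluidPDE.VectorCalculus.IsDivFree (u t)) ∧ (∀ s t : ℝ, s < t → t < 0 → ∀ x, u t x = Literature.Analysis.FluidPDE.heatFlow (u s) (t-s) x - ∫ τ in Set.Ioo s t, ∫ y, ((-(inner ℝ (x-y) (u τ y) / (2*(t-τ)) * Literature.Analysis.UnboundedOperators.heatKernel (t-τ) (x-y))) • u τ y + (∫ σ in Set.Ioi (t-τ), Literature.Analysis.UnboundedOperators.heatKernel σ (x-y) / (4*σ^2)) • (inner ℝ (x-y) (u τ y) • u τ y + inner ℝ (u τ y) (u τ y) • (x-y) + inner ℝ (x-y) (u τ y) • u τ y) - ((∫ σ in Set.Ioi (t-τ), Literature.Analysis.UnboundedOperators.heatKernel σ (x-y) / (8*σ^3)) * (inner ℝ (x-y) (u τ y) * inner ℝ (x-y) (u τ y))) • (x-y))) ∧ Literature.Analysis.FluidPDE.HasTypeITimeDecay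 C u ∧ (∀ (x₀ : EuclideanSpace ℝ (Fin 3)) (t₀ r : ℝ), t₀ ≤ 0 → 0 < r → (∀ t, t₀ - r^2 < t → t < t₀ → r⁻¹ * ∫ x in Metric.ball x₀ r, ‖u t x‖^2 ≤ C) ∧ r⁻¹ * ∫ t in Set.Ioo (t₀ - r^2) t₀, ∫ x in Metric.ball x₀ r, ‖fderiv ℝ (u t) x‖^2 ≤ C)) →
        ∀ t < 0, ∀ x, lerayMiddleStrain u t x ≤ 1 / 4 := by
  constructor
  · intro h C u hu t ht x
    have hC : 0 ≤ C := squeezeClass_constant_nonneg hu.2.2.2.1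
    obtain ⟨w, m, hm0, hw, hGE, hmax⟩ := classMax_attained hC
    have hΛm : lerayMiddleStrain u t x ≤ m := (lerayMiddleStrain_le_iff ht m).2 (hmax u hu t ht x)
    suffices hm4 : m ≤ 1 / 4 from hΛm.trans hm4
    by_contra hgt
    rw [not_le] at hgt
    obtain ⟨K₀, hK₀, hKb⟩ := stub_gaugeStrainBound C
    have hm : 0 < m - 1 / 4 := by linarith
    set Q : ℝ := 2 * m ^ 3 / (m - 1 / 4) with hQ
    have hQ0 : 0 < Q := by positivity
    set K : ℝ := K₀ + Q + 1 with hKdef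
    have hK1 : 1 ≤ K := by rw [hKdef]; linarith
    have hKpos : 0 < K := by linarith
    have hK0K : K₀ ≤ K := by rw [hKdef]; linarith
    have hQK : Q ≤ K ^ 2 := by nlinarith
    have hreg : 1 / 4 ≤ m - 2 * m ^ 3 / K ^ 2 := by
      have h1 : 2 * m ^ 3 / K ^ 2 ≤ 2 * m ^ 3 / Q :=
        div_le_div_of_nonneg_left (by positivity) hQ0 hQK
      have h2 : 2 * m ^ 3 / Q = m - 1 / 4 := by
        rw [hQ]
        have h2m : (2 : ℝ) * m ^ 3 ≠ 0 := by positivity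
        field_simp
      linarith
    have hatt : m ≤ lerayMiddleStrain w (-1) 0 := (le_lerayMiddleStrain_iff (by norm_num) m).2 hGE
    refine h C K m w (-1) 0 hKpos (fun v' hv' s hs y => ⟨?_, (lerayMiddleStrain_le_iff hs m).2
      (hmax v' hv' s hs y)⟩) hm0 hreg (by norm_num) hw hatt
    calc _ ≤ (K₀ / (-s)) ^ 2 := hKb v' hv' s hs y
      _ ≤ (K / (-s)) ^ 2 := by
          have hs' : 0 < -s := neg_pos.2 hs
          gcongr
  · intro h C K m u t₀ x₀ hK hcls hm0 hreg ht₀ hu hatt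
    have hmle : m ≤ 1 / 4 := hatt.trans (h C u hu t₀ ht₀ x₀)
    have h3 : 0 ≤ 2 * m ^ 3 / K ^ 2 := by positivity
    have hz : 2 * m ^ 3 / K ^ 2 = 0 := by linarith
    rw [div_eq_zero_iff] at hz
    rcases hz with hz | hz
    · have hm3 : m ^ 3 = 0 := by linarith
      have hm0' : m = 0 := pow_eq_zero_iff (n := 3) (by norm_num) |>.1 hm3
      rw [hm0'] at hreg
      norm_num at hreg
    · exact absurd hz (by positivity)

/-! ### The open pair is the route target -/

/-- **A refutation of the crux refutes the pair (leaky stub on `[0,1/4)`, `stub_largeExcessExclusion`)**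
— the line's composition re-run over the LANDED stubs (`stub_gaugeStrainBound`, `stub_cubicProductionBound`),
consuming the leaky law only at the threshold `b = m − 2m³/K² ∈ [2m/3, m) ⊂ [0, 1/4)`. [folklore] -/
theorem not_stubPair_of_not_crux (hn : ¬ SqueezeCycle.ExtremalBiaxialitySubcritical) :
    ¬ ((∀ (C b : ℝ), 0 ≤ b → b < 1 / 4 → ∀ (u : ℝ → EuclideanSpace ℝ (Fin 3) → EuclideanSpace ℝ (Fin 3)), ContDiffOn ℝ (⊤ : ℕ∞) (Function.uncurry u) (Set.Iio 0 ×ˢ Set.univ) ∧ (∀ t < 0, Literature.Analysis.FluidPDE.VectorCalculus.IsDivFree (u t)) ∧ (∀ s t : ℝ, s < t → t < 0 → ∀ x, u t x = Literature.Analysis.FluidPDE.heatFlow (u s) (t-s) x - ∫ τ in Set.Ioo s t, ∫ y, ((-(inner ℝ (x-y) (u τ y) / (2*(t-τ)) * Literature.Analysis.UnboundedOperators.heatKernel (t-τ) (x-y))) • u τ y + (∫ σ in Set.Ioi (t-τ), Literature.Analysis.UnboundedOperators.heatKernel σ (x-y) / (4*σ^2)) • (inner ℝ (x-y) (u τ y)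 • u τ y + inner ℝ (u τ y) (u τ y) • (x-y) + inner ℝ (x-y) (u τ y) • u τ y) - ((∫ σ in Set.Ioi (t-τ), Literature.Analysis.UnboundedOperators.heatKernel σ (x-y) / (8*σ^3)) * (inner ℝ (x-y) (u τ y) * inner ℝ (x-y) (u τ y))) • (x-y))) ∧ Literature.Analysis.FluidPDE.HasTypeITimeDecay C u ∧ (∀ (x₀ : EuclideanSpace ℝ (Fin 3)) (t₀ r : ℝ), t₀ ≤ 0 → 0 < r → (∀ t, t₀ - r^2 < t → t < t₀ → r⁻¹ * ∫ x in Metric.ball x₀ r, ‖u t x‖^2 ≤ C) ∧ r⁻¹ * ∫ t in Set.Ioo (t₀ - r^2) t₀, ∫ x in Metric.ball x₀ r, ‖fderiv ℝ (u t) x‖^2 ≤ C) → (∀ t < 0, ∀ x, -4 * (((1 / 2 : ℝ) • (Literature.Analysis.FluidPDE.stdMatrix (fderiv ℝ (u t) x : EuclideanSpace ℝ (Fin 3) →ₗ[ℝ] EuclideanSpace ℝ (Fin 3)) + (Literature.Analysis.FluidPDE.stdMatrix (fderiv ℝ (u t) x : EuclideanSpace ℝ (Fin 3) →ₗ[ℝ]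 EuclideanSpace ℝ (Fin 3)))ᵀ))).det ≤ (2 * b / (-t)) * (∑ i, ∑ j, (((1 / 2 : ℝ) • (Literature.Analysis.FluidPDE.stdMatrix (fderiv ℝ (u t) x : EuclideanSpace ℝ (Fin 3) →ₗ[ℝ] EuclideanSpace ℝ (Fin 3)) + (Literature.Analysis.FluidPDE.stdMatrix (fderiv ℝ (u t) x : EuclideanSpace ℝ (Fin 3) →ₗ[ℝ] EuclideanSpace ℝ (Fin 3)))ᵀ)) i j) ^ 2)) → ∀ t < 0, ∀ x, u t x = 0) ∧
       (∀ (C K m : ℝ) (u : ℝ → EuclideanSpace ℝ (Fin 3) → EuclideanSpace ℝ (Fin 3)) (t₀ : ℝ) (x₀ : EuclideanSpace ℝ (Fin 3)), 0 < K → (∀ (v' : ℝ → EuclideanSpace ℝ (Fin 3) → EuclideanSpace ℝ (Fin 3)), ContDiffOn ℝ (⊤ : ℕ∞) (Function.uncurry v') (Set.Iio 0 ×ˢ Set.univ) ∧ (∀ t < 0, Literature.Analysis.FluidPDE.VectorCalculus.IsDivFree (v' t)) ∧ (∀ s t : ℝ, s < t → t < 0 → ∀ x, v' t x = Literature.Analysis.FluidPDE.heatFlow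 (v' s) (t-s) x - ∫ τ in Set.Ioo s t, ∫ y, ((-(inner ℝ (x-y) (v' τ y) / (2*(t-τ)) * Literature.Analysis.UnboundedOperators.heatKernel (t-τ) (x-y))) • v' τ y + (∫ σ in Set.Ioi (t-τ), Literature.Analysis.UnboundedOperators.heatKernel σ (x-y) / (4*σ^2)) • (inner ℝ (x-y) (v' τ y) • v' τ y + inner ℝ (v' τ y) (v' τ y) • (x-y) + inner ℝ (x-y) (v' τ y) • v' τ y) - ((∫ σ in Set.Ioi (t-τ), Literature.Analysis.UnboundedOperators.heatKernel σ (x-y) / (8*σ^3)) * (inner ℝ (x-y) (v' τ y) * inner ℝ (x-y) (v' τ y))) • (x-y))) ∧ Literature.Analysis.FluidPDE.HasTypeITimeDecay C v' ∧ (∀ (x₀ : EuclideanSpace ℝ (Fin 3)) (t₀ r : ℝ), t₀ ≤ 0 → 0 < r → (∀ t, t₀ - r^2 < t → t < t₀ → r⁻¹ * ∫ x in Metric.ball x₀ r, ‖v' t x‖^2 ≤ C) ∧ r⁻¹ * ∫ t in Set.Ioo (t₀ - r^2) t₀, ∫ x in Metric.ball x₀ r, ‖fderiv ℝ (v' t)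 x‖^2 ≤ C) → ∀ t < 0, ∀ x, (∑ i, ∑ j, (((1 / 2 : ℝ) • (Literature.Analysis.FluidPDE.stdMatrix (fderiv ℝ (v' t) x : EuclideanSpace ℝ (Fin 3) →ₗ[ℝ] EuclideanSpace ℝ (Fin 3)) + (Literature.Analysis.FluidPDE.stdMatrix (fderiv ℝ (v' t) x : EuclideanSpace ℝ (Fin 3) →ₗ[ℝ] EuclideanSpace ℝ (Fin 3)))ᵀ)) i j) ^ 2) ≤ (K / (-t)) ^ 2 ∧ Literature.Analysis.FluidPDE.lerayMiddleStrain v' t x ≤ m) → 0 ≤ m → 1 / 4 ≤ m - 2 * m ^ 3 / K ^ 2 → t₀ < 0 → (ContDiffOn ℝ (⊤ : ℕ∞) (Function.uncurry u) (Set.Iio 0 ×ˢ Set.univ) ∧ (∀ t < 0, Literature.Analysis.FluidPDE.VectorCalculus.IsDivFree (u t)) ∧ (∀ s t : ℝ, s < t → t < 0 → ∀ x, u t x = Literature.Analysis.FluidPDE.heatFlow (u s) (t-s) x - ∫ τ in Set.Ioo s t, ∫ y, ((-(inner ℝ (x-y) (u τ y) / (2*(t-τ)) * Literature.Analysis.UnboundedOperators.heatKernel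 (t-τ) (x-y))) • u τ y + (∫ σ in Set.Ioi (t-τ), Literature.Analysis.UnboundedOperators.heatKernel σ (x-y) / (4*σ^2)) • (inner ℝ (x-y) (u τ y) • u τ y + inner ℝ (u τ y) (u τ y) • (x-y) + inner ℝ (x-y) (u τ y) • u τ y) - ((∫ σ in Set.Ioi (t-τ), Literature.Analysis.UnboundedOperators.heatKernel σ (x-y) / (8*σ^3)) * (inner ℝ (x-y) (u τ y) * inner ℝ (x-y) (u τ y))) • (x-y))) ∧ Literature.Analysis.FluidPDE.HasTypeITimeDecay C u ∧ (∀ (x₀ : EuclideanSpace ℝ (Fin 3)) (t₀ r : ℝ), t₀ ≤ 0 → 0 < r → (∀ t, t₀ - r^2 < t → t < t₀ → r⁻¹ * ∫ x in Metric.ball x₀ r, ‖u t x‖^2 ≤ C) ∧ r⁻¹ * ∫ t in Set.Ioo (t₀ - r^2) t₀, ∫ x in Metric.ball x₀ r, ‖fderiv ℝ (u t) x‖^2 ≤ C)) → m ≤ Literature.Analysis.FluidPDE.lerayMiddleStrain u t₀ x₀ → False)) := by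
  rintro ⟨hL, hE⟩
  apply hn
  intro C m u t₀ x₀ ht₀ hu hGE hmax
  obtain ⟨K, hK, hKb⟩ := stub_gaugeStrainBound C
  have hC : 0 ≤ C := squeezeClass_constant_nonneg hu.2.2.2.1
  have hm0 : 0 ≤ m := nonneg_of_maximal hC hmax
  obtain ⟨hΛeq, hΛle⟩ := extremal_lerayMiddleStrain_eq ht₀ hu hGE hmax
  by_cases hreg : 1 / 4 ≤ m - 2 * m ^ 3 / K ^ 2
  · exact (hE C K m u t₀ x₀ hK
      (fun v' hv' t ht x => ⟨hKb v' hv' t ht x, hΛle v' hv' t ht x⟩) hm0 hreg ht₀ hu hΛeq.ge).elim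
  · replace hreg : m - 2 * m ^ 3 / K ^ 2 < 1 / 4 := not_le.1 hreg
    set b : ℝ := m - 2 * m ^ 3 / K ^ 2 with hb
    obtain ⟨h1, h2, h3, h4, h5⟩ := hu
    have htr : ∀ t < 0, ∀ x, (stdMatrix (fderiv ℝ (u t) x : (EuclideanSpace ℝ (Fin 3)) →ₗ[ℝ] (EuclideanSpace ℝ (Fin 3)))).trace = 0 := by
      intro t ht x
      rw [trace_stdMatrix]
      exact h2 t ht x
    have h6 : 6 * m ^ 2 ≤ K ^ 2 := by
      set M := stdMatrix (fderiv ℝ (u t₀) x₀ : (EuclideanSpace ℝ (Fin 3)) →ₗ[ℝ] (EuclideanSpace ℝ (Fin 3))) with hM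
      have hsix := six_mul_midStrain_sq_le M (htr t₀ ht₀ x₀)
      have hS := hKb u ⟨h1, h2, h3, h4, h5⟩ t₀ ht₀ x₀
      have hΛ : lerayMiddleStrain u t₀ x₀ =
          (-t₀) * (2⁻¹ * (Matrix.isHermitian_add_transpose_self M).eigenvalues₀ 1) :=
        lerayMiddleStrain_eq_eigenvalues₀
      rw [hΛeq] at hΛ
      have hKt : ((K / (-t₀)) ^ 2) * (-t₀) ^ 2 = K ^ 2 := by
        have ht0 : t₀ ≠ 0 := ht₀.ne
        field_simp
      set σ := ∑ i, ∑ j, (((1 / 2 : ℝ) • (M + Mᵀ)) i j) ^ 2 with hσ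
      set μ := (Matrix.isHermitian_add_transpose_self M).eigenvalues₀ 1 with hμ
      have hσK : σ * (-t₀) ^ 2 ≤ K ^ 2 := by
        rw [← hKt]
        exact mul_le_mul_of_nonneg_right hS (sq_nonneg _)
      calc 6 * m ^ 2 = (3 / 2 * μ ^ 2) * (-t₀) ^ 2 := by rw [hΛ]; ring
        _ ≤ σ * (-t₀) ^ 2 := mul_le_mul_of_nonneg_right hsix (sq_nonneg _)
        _ ≤ K ^ 2 := hσK
    have hb0 : 0 ≤ b := by
      have hK2 : 0 < K ^ 2 := by positivity
      have h1' : 2 * m ^ 3 / K ^ 2 ≤ m / 3 := by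
        rw [div_le_iff₀ hK2]
        nlinarith
      rw [hb]
      linarith
    have hceil : ∀ t < 0, ∀ x, -4 * (((1 / 2 : ℝ) • (Literature.Analysis.FluidPDE.stdMatrix (fderiv ℝ (u t) x : EuclideanSpace ℝ (Fin 3) →ₗ[ℝ] EuclideanSpace ℝ (Fin 3)) + (Literature.Analysis.FluidPDE.stdMatrix (fderiv ℝ (u t) x : EuclideanSpace ℝ (Fin 3) →ₗ[ℝ] EuclideanSpace ℝ (Fin 3)))ᵀ))).det ≤ (2 * b / (-t)) * (∑ i, ∑ j, (((1 / 2 : ℝ) • (Literature.Analysis.FluidPDE.stdMatrix (fderiv ℝ (u t) x : EuclideanSpace ℝ (Fin 3) →ₗ[ℝ] EuclideanSpace ℝ (Fin 3)) + (Literature.Analysis.FluidPDE.stdMatrix (fderiv ℝ (u t) x : EuclideanSpace ℝ (Fin 3) →ₗ[ℝ] EuclideanSpace ℝ (Fin 3)))ᵀ)) i j) ^ 2) := by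
      intro t ht x
      have ht' : 0 < -t := neg_pos.2 ht
      set M := stdMatrix (fderiv ℝ (u t) x : (EuclideanSpace ℝ (Fin 3)) →ₗ[ℝ] (EuclideanSpace ℝ (Fin 3))) with hM
      have hΛle_u : lerayMiddleStrain u t x ≤ m := hΛle u ⟨h1, h2, h3, h4, h5⟩ t ht x
      have hΛ : lerayMiddleStrain u t x =
          (-t) * (2⁻¹ * (Matrix.isHermitian_add_transpose_self M).eigenvalues₀ 1) :=
        lerayMiddleStrain_eq_eigenvalues₀
      have hμ : (Matrix.isHermitian_add_transpose_self M).eigenvalues₀ 1 ≤ 2 * (m / (-t)) := by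
        rw [hΛ] at hΛle_u
        rw [mul_div_assoc', le_div_iff₀ ht']
        nlinarith
      have hmK : 6 * (m / (-t)) ^ 2 ≤ (K / (-t)) ^ 2 := by
        rw [div_pow, div_pow]
        exact (by
          rw [← mul_div_assoc]
          exact div_le_div_of_nonneg_right h6 (sq_nonneg _) :
            6 * (m ^ 2 / (-t) ^ 2) ≤ K ^ 2 / (-t) ^ 2)
      have hcub := stub_cubicProductionBound M (m / (-t)) (K / (-t)) (htr t ht x)
        (div_nonneg hm0 ht'.le) (div_pos hK ht') hmK hμ (hKb u ⟨h1, h2, h3, h4, h5⟩ t ht x)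
      have hcoef : 2 * (m / (-t)) - 4 * (m / (-t)) ^ 3 / (K / (-t)) ^ 2 = 2 * b / (-t) := by
        rw [hb]
        field_simp
        ring
      rw [hcoef] at hcub
      exact hcub
    have hz : ∀ t < 0, ∀ x, u t x = 0 := hL C b hb0 hreg u ⟨h1, h2, h3, h4, h5⟩ hceil
    have hm : m ≤ 0 := nonpos_of_twoFrame_lower_of_slice_zero (hz t₀ ht₀) hGE
    linarith

/-- **X ⇒ both open stubs** (VERBATIM). [folklore] -/
theorem stubPair_of_squeezeLiouville (hX : SqueezeCycle.SqueezeLiouville) :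
    (∀ (C b : ℝ), b < 1 / 4 → ∀ (u : ℝ → EuclideanSpace ℝ (Fin 3) → EuclideanSpace ℝ (Fin 3)), ContDiffOn ℝ (⊤ : ℕ∞) (Function.uncurry u) (Set.Iio 0 ×ˢ Set.univ) ∧ (∀ t < 0, Literature.Analysis.FluidPDE.VectorCalculus.IsDivFree (u t)) ∧ (∀ s t : ℝ, s < t → t < 0 → ∀ x, u t x = Literature.Analysis.FluidPDE.heatFlow (u s) (t-s) x - ∫ τ in Set.Ioo s t, ∫ y, ((-(inner ℝ (x-y) (u τ y) / (2*(t-τ)) * Literature.Analysis.UnboundedOperators.heatKernel (t-τ) (x-y))) • u τ y + (∫ σ in Set.Ioi (t-τ), Literature.Analysis.UnboundedOperators.heatKernel σ (x-y) / (4*σ^2)) • (inner ℝ (x-y) (u τ y) • u τ y + inner ℝ (u τ y) (u τ y) • (x-y) + inner ℝ (x-y) (u τ y) • u τ y) - ((∫ σ in Set.Ioi (t-τ), Literature.Analysis.UnboundedOperators.heatKernel σ (x-y) / (8*σ^3)) * (inner ℝ (x-y) (u τ y) * inner ℝ (x-y) (u τ y))) • (x-y))) ∧ Literature.Analysis.FluidPDE.HasTypeITimeDecay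 C u ∧ (∀ (x₀ : EuclideanSpace ℝ (Fin 3)) (t₀ r : ℝ), t₀ ≤ 0 → 0 < r → (∀ t, t₀ - r^2 < t → t < t₀ → r⁻¹ * ∫ x in Metric.ball x₀ r, ‖u t x‖^2 ≤ C) ∧ r⁻¹ * ∫ t in Set.Ioo (t₀ - r^2) t₀, ∫ x in Metric.ball x₀ r, ‖fderiv ℝ (u t) x‖^2 ≤ C) → (∀ t < 0, ∀ x, -4 * (((1 / 2 : ℝ) • (Literature.Analysis.FluidPDE.stdMatrix (fderiv ℝ (u t) x : EuclideanSpace ℝ (Fin 3) →ₗ[ℝ] EuclideanSpace ℝ (Fin 3)) + (Literature.Analysis.FluidPDE.stdMatrix (fderiv ℝ (u t) x : EuclideanSpace ℝ (Fin 3) →ₗ[ℝ] EuclideanSpace ℝ (Fin 3)))ᵀ))).det ≤ (2 * b / (-t)) * (∑ i, ∑ j, (((1 / 2 : ℝ) • (Literature.Analysis.FluidPDE.stdMatrix (fderiv ℝ (u t) x : EuclideanSpace ℝ (Fin 3) →ₗ[ℝ] EuclideanSpace ℝ (Fin 3)) + (Literature.Analysis.FluidPDE.stdMatrix (fderiv ℝ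 (u t) x : EuclideanSpace ℝ (Fin 3) →ₗ[ℝ] EuclideanSpace ℝ (Fin 3)))ᵀ)) i j) ^ 2)) → ∀ t < 0, ∀ x, u t x = 0) ∧
      (∀ (C K m : ℝ) (u : ℝ → EuclideanSpace ℝ (Fin 3) → EuclideanSpace ℝ (Fin 3)) (t₀ : ℝ) (x₀ : EuclideanSpace ℝ (Fin 3)), 0 < K → (∀ (v' : ℝ → EuclideanSpace ℝ (Fin 3) → EuclideanSpace ℝ (Fin 3)), ContDiffOn ℝ (⊤ : ℕ∞) (Function.uncurry v') (Set.Iio 0 ×ˢ Set.univ) ∧ (∀ t < 0, Literature.Analysis.FluidPDE.VectorCalculus.IsDivFree (v' t)) ∧ (∀ s t : ℝ, s < t → t < 0 → ∀ x, v' t x = Literature.Analysis.FluidPDE.heatFlow (v' s) (t-s) x - ∫ τ in Set.Ioo s t, ∫ y, ((-(inner ℝ (x-y) (v' τ y) / (2*(t-τ)) * Literature.Analysis.UnboundedOperators.heatKernel (t-τ) (x-y))) • v' τ y + (∫ σ in Set.Ioi (t-τ), Literature.Analysis.UnboundedOperators.heatKernel σ (x-y) / (4*σ^2)) • (inner ℝ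 (x-y) (v' τ y) • v' τ y + inner ℝ (v' τ y) (v' τ y) • (x-y) + inner ℝ (x-y) (v' τ y) • v' τ y) - ((∫ σ in Set.Ioi (t-τ), Literature.Analysis.UnboundedOperators.heatKernel σ (x-y) / (8*σ^3)) * (inner ℝ (x-y) (v' τ y) * inner ℝ (x-y) (v' τ y))) • (x-y))) ∧ Literature.Analysis.FluidPDE.HasTypeITimeDecay C v' ∧ (∀ (x₀ : EuclideanSpace ℝ (Fin 3)) (t₀ r : ℝ), t₀ ≤ 0 → 0 < r → (∀ t, t₀ - r^2 < t → t < t₀ → r⁻¹ * ∫ x in Metric.ball x₀ r, ‖v' t x‖^2 ≤ C) ∧ r⁻¹ * ∫ t in Set.Ioo (t₀ - r^2) t₀, ∫ x in Metric.ball x₀ r, ‖fderiv ℝ (v' t) x‖^2 ≤ C) → ∀ t < 0, ∀ x, (∑ i, ∑ j, (((1 / 2 : ℝ) • (Literature.Analysis.FluidPDE.stdMatrix (fderiv ℝ (v' t) x : EuclideanSpace ℝ (Fin 3) →ₗ[ℝ] EuclideanSpace ℝ (Fin 3)) + (Literature.Analysis.FluidPDE.stdMatrix (fderiv ℝ (v'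 t) x : EuclideanSpace ℝ (Fin 3) →ₗ[ℝ] EuclideanSpace ℝ (Fin 3)))ᵀ)) i j) ^ 2) ≤ (K / (-t)) ^ 2 ∧ Literature.Analysis.FluidPDE.lerayMiddleStrain v' t x ≤ m) → 0 ≤ m → 1 / 4 ≤ m - 2 * m ^ 3 / K ^ 2 → t₀ < 0 → (ContDiffOn ℝ (⊤ : ℕ∞) (Function.uncurry u) (Set.Iio 0 ×ˢ Set.univ) ∧ (∀ t < 0, Literature.Analysis.FluidPDE.VectorCalculus.IsDivFree (u t)) ∧ (∀ s t : ℝ, s < t → t < 0 → ∀ x, u t x = Literature.Analysis.FluidPDE.heatFlow (u s) (t-s) x - ∫ τ in Set.Ioo s t, ∫ y, ((-(inner ℝ (x-y) (u τ y) / (2*(t-τ)) * Literature.Analysis.UnboundedOperators.heatKernel (t-τ) (x-y))) • u τ y + (∫ σ in Set.Ioi (t-τ), Literature.Analysis.UnboundedOperators.heatKernel σ (x-y) / (4*σ^2)) • (inner ℝ (x-y) (u τ y) • u τ y + inner ℝ (u τ y) (u τ y) • (x-y) + inner ℝ (x-y) (u τ y) • u τ y) - ((∫ σ in Set.Ioi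 (t-τ), Literature.Analysis.UnboundedOperators.heatKernel σ (x-y) / (8*σ^3)) * (inner ℝ (x-y) (u τ y) * inner ℝ (x-y) (u τ y))) • (x-y))) ∧ Literature.Analysis.FluidPDE.HasTypeITimeDecay C u ∧ (∀ (x₀ : EuclideanSpace ℝ (Fin 3)) (t₀ r : ℝ), t₀ ≤ 0 → 0 < r → (∀ t, t₀ - r^2 < t → t < t₀ → r⁻¹ * ∫ x in Metric.ball x₀ r, ‖u t x‖^2 ≤ C) ∧ r⁻¹ * ∫ t in Set.Ioo (t₀ - r^2) t₀, ∫ x in Metric.ball x₀ r, ‖fderiv ℝ (u t) x‖^2 ≤ C)) → m ≤ Literature.Analysis.FluidPDE.lerayMiddleStrain u t₀ x₀ → False) :=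
  ⟨fun C _ _ u hu _ => hX C u hu, largeExcess_of_crux (extremalBiaxialitySubcritical_of_squeezeLiouville hX)⟩

/-- **¬X ⇒ one of the two open stubs fails** (through `MustSqueeze` from the leaky stub and the crux
from the pair, `Negative.squeezeLiouville_of_mustSqueeze_of_withoutMaximality`). [folklore] -/
theorem not_stubPair_of_not_squeezeLiouville (hn : ¬ SqueezeCycle.SqueezeLiouville) :
    ¬ ((∀ (C b : ℝ), b < 1 / 4 → ∀ (u : ℝ → EuclideanSpace ℝ (Fin 3) → EuclideanSpace ℝ (Fin 3)), ContDiffOn ℝ (⊤ : ℕ∞) (Function.uncurry u) (Set.Iio 0 ×ˢ Set.univ) ∧ (∀ t < 0, Literature.Analysis.FluidPDE.VectorCalculus.IsDivFree (u t)) ∧ (∀ s t : ℝ, s < t → t < 0 → ∀ x, u t x = Literature.Analysis.FluidPDE.heatFlow (u s) (t-s) x - ∫ τ in Set.Ioo s t, ∫ y, ((-(inner ℝ (x-y) (u τ y) / (2*(t-τ)) * Literature.Analysis.UnboundedOperators.heatKernel (t-τ) (x-y))) • u τ y + (∫ σ in Set.Ioi (t-τ), Literature.Analysis.UnboundedOperators.heatKernel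 σ (x-y) / (4*σ^2)) • (inner ℝ (x-y) (u τ y) • u τ y + inner ℝ (u τ y) (u τ y) • (x-y) + inner ℝ (x-y) (u τ y) • u τ y) - ((∫ σ in Set.Ioi (t-τ), Literature.Analysis.UnboundedOperators.heatKernel σ (x-y) / (8*σ^3)) * (inner ℝ (x-y) (u τ y) * inner ℝ (x-y) (u τ y))) • (x-y))) ∧ Literature.Analysis.FluidPDE.HasTypeITimeDecay C u ∧ (∀ (x₀ : EuclideanSpace ℝ (Fin 3)) (t₀ r : ℝ), t₀ ≤ 0 → 0 < r → (∀ t, t₀ - r^2 < t → t < t₀ → r⁻¹ * ∫ x in Metric.ball x₀ r, ‖u t x‖^2 ≤ C) ∧ r⁻¹ * ∫ t in Set.Ioo (t₀ - r^2) t₀, ∫ x in Metric.ball x₀ r, ‖fderiv ℝ (u t) x‖^2 ≤ C) → (∀ t < 0, ∀ x, -4 * (((1 / 2 : ℝ) • (Literature.Analysis.FluidPDE.stdMatrix (fderiv ℝ (u t) x : EuclideanSpace ℝ (Fin 3) →ₗ[ℝ] EuclideanSpace ℝ (Fin 3)) + (Literature.Analysis.FluidPDE.stdMatrix (fderiv ℝ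 (u t) x : EuclideanSpace ℝ (Fin 3) →ₗ[ℝ] EuclideanSpace ℝ (Fin 3)))ᵀ))).det ≤ (2 * b / (-t)) * (∑ i, ∑ j, (((1 / 2 : ℝ) • (Literature.Analysis.FluidPDE.stdMatrix (fderiv ℝ (u t) x : EuclideanSpace ℝ (Fin 3) →ₗ[ℝ] EuclideanSpace ℝ (Fin 3)) + (Literature.Analysis.FluidPDE.stdMatrix (fderiv ℝ (u t) x : EuclideanSpace ℝ (Fin 3) →ₗ[ℝ] EuclideanSpace ℝ (Fin 3)))ᵀ)) i j) ^ 2)) → ∀ t < 0, ∀ x, u t x = 0) ∧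
       (∀ (C K m : ℝ) (u : ℝ → EuclideanSpace ℝ (Fin 3) → EuclideanSpace ℝ (Fin 3)) (t₀ : ℝ) (x₀ : EuclideanSpace ℝ (Fin 3)), 0 < K → (∀ (v' : ℝ → EuclideanSpace ℝ (Fin 3) → EuclideanSpace ℝ (Fin 3)), ContDiffOn ℝ (⊤ : ℕ∞) (Function.uncurry v') (Set.Iio 0 ×ˢ Set.univ) ∧ (∀ t < 0, Literature.Analysis.FluidPDE.VectorCalculus.IsDivFree (v' t)) ∧ (∀ s t : ℝ, s < t → t < 0 → ∀ x, v' t x = Literature.Analysis.FluidPDE.heatFlow (v' s) (t-s) x - ∫ τ in Set.Ioo s t, ∫ y, ((-(inner ℝ (x-y) (v' τ y) / (2*(t-τ)) * Literature.Analysis.UnboundedOperators.heatKernel (t-τ) (x-y))) • v' τ y + (∫ σ in Set.Ioi (t-τ), Literature.Analysis.UnboundedOperators.heatKernel σ (x-y) / (4*σ^2)) • (inner ℝ (x-y) (v' τ y) • v' τ y + inner ℝ (v' τ y) (v' τ y) • (x-y) + inner ℝ (x-y) (v' τ y) • v' τ y) - ((∫ σ in Set.Ioi (t-τ), Literature.Analysis.UnboundedOperators.heatKernel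 σ (x-y) / (8*σ^3)) * (inner ℝ (x-y) (v' τ y) * inner ℝ (x-y) (v' τ y))) • (x-y))) ∧ Literature.Analysis.FluidPDE.HasTypeITimeDecay C v' ∧ (∀ (x₀ : EuclideanSpace ℝ (Fin 3)) (t₀ r : ℝ), t₀ ≤ 0 → 0 < r → (∀ t, t₀ - r^2 < t → t < t₀ → r⁻¹ * ∫ x in Metric.ball x₀ r, ‖v' t x‖^2 ≤ C) ∧ r⁻¹ * ∫ t in Set.Ioo (t₀ - r^2) t₀, ∫ x in Metric.ball x₀ r, ‖fderiv ℝ (v' t) x‖^2 ≤ C) → ∀ t < 0, ∀ x, (∑ i, ∑ j, (((1 / 2 : ℝ) • (Literature.Analysis.FluidPDE.stdMatrix (fderiv ℝ (v' t) x : EuclideanSpace ℝ (Fin 3) →ₗ[ℝ] EuclideanSpace ℝ (Fin 3)) + (Literature.Analysis.FluidPDE.stdMatrix (fderiv ℝ (v' t) x : EuclideanSpace ℝ (Fin 3) →ₗ[ℝ] EuclideanSpace ℝ (Fin 3)))ᵀ)) i j) ^ 2) ≤ (K / (-t)) ^ 2 ∧ Literature.Analysis.FluidPDE.lerayMiddleStrain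 v' t x ≤ m) → 0 ≤ m → 1 / 4 ≤ m - 2 * m ^ 3 / K ^ 2 → t₀ < 0 → (ContDiffOn ℝ (⊤ : ℕ∞) (Function.uncurry u) (Set.Iio 0 ×ˢ Set.univ) ∧ (∀ t < 0, Literature.Analysis.FluidPDE.VectorCalculus.IsDivFree (u t)) ∧ (∀ s t : ℝ, s < t → t < 0 → ∀ x, u t x = Literature.Analysis.FluidPDE.heatFlow (u s) (t-s) x - ∫ τ in Set.Ioo s t, ∫ y, ((-(inner ℝ (x-y) (u τ y) / (2*(t-τ)) * Literature.Analysis.UnboundedOperators.heatKernel (t-τ) (x-y))) • u τ y + (∫ σ in Set.Ioi (t-τ), Literature.Analysis.UnboundedOperators.heatKernel σ (x-y) / (4*σ^2)) • (inner ℝ (x-y) (u τ y) • u τ y + inner ℝ (u τ y) (u τ y) • (x-y) + inner ℝ (x-y) (u τ y) • u τ y) - ((∫ σ in Set.Ioi (t-τ), Literature.Analysis.UnboundedOperators.heatKernel σ (x-y) / (8*σ^3)) * (inner ℝ (x-y) (u τ y) * inner ℝ (x-y) (u τ y))) • (x-y))) ∧ Literature.Analysis.FluidPDE.HasTypeITimeDecay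 C u ∧ (∀ (x₀ : EuclideanSpace ℝ (Fin 3)) (t₀ r : ℝ), t₀ ≤ 0 → 0 < r → (∀ t, t₀ - r^2 < t → t < t₀ → r⁻¹ * ∫ x in Metric.ball x₀ r, ‖u t x‖^2 ≤ C) ∧ r⁻¹ * ∫ t in Set.Ioo (t₀ - r^2) t₀, ∫ x in Metric.ball x₀ r, ‖fderiv ℝ (u t) x‖^2 ≤ C)) → m ≤ Literature.Analysis.FluidPDE.lerayMiddleStrain u t₀ x₀ → False)) := by
  rintro ⟨hL, hE⟩
  have hL' := leaky_iff_leakyNonneg.1 hL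
  by_cases hX : SqueezeCycle.ExtremalBiaxialitySubcritical
  · exact hn (squeezeLiouville_of_mustSqueeze_of_withoutMaximality
      (msFamily_of_leakyNonneg hL' (1 / 8) (by norm_num)) (withoutMaximality_of_crux hX))
  · exact not_stubPair_of_not_crux hX ⟨hL', hE⟩

/-- **The open stub pair of line `quarter-bootstrap-pinning` is exactly as strong as the route target:**
`¬X ⇔ ¬stub_leakyQuarterLawCeiling ∨ ¬stub_largeExcessExclusion` (both VERBATIM). [folklore] -/
theorem not_squeezeLiouville_iff :
    ¬ SqueezeCycle.SqueezeLiouville ↔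
      ¬ (∀ (C b : ℝ), b < 1 / 4 → ∀ (u : ℝ → EuclideanSpace ℝ (Fin 3) → EuclideanSpace ℝ (Fin 3)), ContDiffOn ℝ (⊤ : ℕ∞) (Function.uncurry u) (Set.Iio 0 ×ˢ Set.univ) ∧ (∀ t < 0, Literature.Analysis.FluidPDE.VectorCalculus.IsDivFree (u t)) ∧ (∀ s t : ℝ, s < t → t < 0 → ∀ x, u t x = Literature.Analysis.FluidPDE.heatFlow (u s) (t-s) x - ∫ τ in Set.Ioo s t, ∫ y, ((-(inner ℝ (x-y) (u τ y) / (2*(t-τ)) * Literature.Analysis.UnboundedOperators.heatKernel (t-τ) (x-y))) • u τ y + (∫ σ in Set.Ioi (t-τ), Literature.Analysis.UnboundedOperators.heatKernel σ (x-y) / (4*σ^2)) • (inner ℝ (x-y) (u τ y) • u τ y + inner ℝ (u τ y) (u τ y) • (x-y) + inner ℝ (x-y) (u τ y) • u τ y) - ((∫ σ in Set.Ioi (t-τ), Literature.Analysis.UnboundedOperators.heatKernel σ (x-y) / (8*σ^3)) * (inner ℝ (x-y) (u τ y) * inner ℝ (x-y) (u τ y))) • (x-y))) ∧ Literature.Analysis.FluidPDE.HasTypeITimeDecay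 C u ∧ (∀ (x₀ : EuclideanSpace ℝ (Fin 3)) (t₀ r : ℝ), t₀ ≤ 0 → 0 < r → (∀ t, t₀ - r^2 < t → t < t₀ → r⁻¹ * ∫ x in Metric.ball x₀ r, ‖u t x‖^2 ≤ C) ∧ r⁻¹ * ∫ t in Set.Ioo (t₀ - r^2) t₀, ∫ x in Metric.ball x₀ r, ‖fderiv ℝ (u t) x‖^2 ≤ C) → (∀ t < 0, ∀ x, -4 * (((1 / 2 : ℝ) • (Literature.Analysis.FluidPDE.stdMatrix (fderiv ℝ (u t) x : EuclideanSpace ℝ (Fin 3) →ₗ[ℝ] EuclideanSpace ℝ (Fin 3)) + (Literature.Analysis.FluidPDE.stdMatrix (fderiv ℝ (u t) x : EuclideanSpace ℝ (Fin 3) →ₗ[ℝ] EuclideanSpace ℝ (Fin 3)))ᵀ))).det ≤ (2 * b / (-t)) * (∑ i, ∑ j, (((1 / 2 : ℝ) • (Literature.Analysis.FluidPDE.stdMatrix (fderiv ℝ (u t) x : EuclideanSpace ℝ (Fin 3) →ₗ[ℝ] EuclideanSpace ℝ (Fin 3)) + (Literature.Analysis.FluidPDE.stdMatrix (fderiv ℝ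 (u t) x : EuclideanSpace ℝ (Fin 3) →ₗ[ℝ] EuclideanSpace ℝ (Fin 3)))ᵀ)) i j) ^ 2)) → ∀ t < 0, ∀ x, u t x = 0) ∨
      ¬ (∀ (C K m : ℝ) (u : ℝ → EuclideanSpace ℝ (Fin 3) → EuclideanSpace ℝ (Fin 3)) (t₀ : ℝ) (x₀ : EuclideanSpace ℝ (Fin 3)), 0 < K → (∀ (v' : ℝ → EuclideanSpace ℝ (Fin 3) → EuclideanSpace ℝ (Fin 3)), ContDiffOn ℝ (⊤ : ℕ∞) (Function.uncurry v') (Set.Iio 0 ×ˢ Set.univ) ∧ (∀ t < 0, Literature.Analysis.FluidPDE.VectorCalculus.IsDivFree (v' t)) ∧ (∀ s t : ℝ, s < t → t < 0 → ∀ x, v' t x = Literature.Analysis.FluidPDE.heatFlow (v' s) (t-s) x - ∫ τ in Set.Ioo s t, ∫ y, ((-(inner ℝ (x-y) (v' τ y) / (2*(t-τ)) * Literature.Analysis.UnboundedOperators.heatKernel (t-τ) (x-y))) • v' τ y + (∫ σ in Set.Ioi (t-τ), Literature.Analysis.UnboundedOperators.heatKernel σ (x-y) / (4*σ^2)) • (inner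 ℝ (x-y) (v' τ y) • v' τ y + inner ℝ (v' τ y) (v' τ y) • (x-y) + inner ℝ (x-y) (v' τ y) • v' τ y) - ((∫ σ in Set.Ioi (t-τ), Literature.Analysis.UnboundedOperators.heatKernel σ (x-y) / (8*σ^3)) * (inner ℝ (x-y) (v' τ y) * inner ℝ (x-y) (v' τ y))) • (x-y))) ∧ Literature.Analysis.FluidPDE.HasTypeITimeDecay C v' ∧ (∀ (x₀ : EuclideanSpace ℝ (Fin 3)) (t₀ r : ℝ), t₀ ≤ 0 → 0 < r → (∀ t, t₀ - r^2 < t → t < t₀ → r⁻¹ * ∫ x in Metric.ball x₀ r, ‖v' t x‖^2 ≤ C) ∧ r⁻¹ * ∫ t in Set.Ioo (t₀ - r^2) t₀, ∫ x in Metric.ball x₀ r, ‖fderiv ℝ (v' t) x‖^2 ≤ C) → ∀ t < 0, ∀ x, (∑ i, ∑ j, (((1 / 2 : ℝ) • (Literature.Analysis.FluidPDE.stdMatrix (fderiv ℝ (v' t) x : EuclideanSpace ℝ (Fin 3) →ₗ[ℝ] EuclideanSpace ℝ (Fin 3)) + (Literature.Analysis.FluidPDE.stdMatrix (fderiv ℝ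 (v' t) x : EuclideanSpace ℝ (Fin 3) →ₗ[ℝ] EuclideanSpace ℝ (Fin 3)))ᵀ)) i j) ^ 2) ≤ (K / (-t)) ^ 2 ∧ Literature.Analysis.FluidPDE.lerayMiddleStrain v' t x ≤ m) → 0 ≤ m → 1 / 4 ≤ m - 2 * m ^ 3 / K ^ 2 → t₀ < 0 → (ContDiffOn ℝ (⊤ : ℕ∞) (Function.uncurry u) (Set.Iio 0 ×ˢ Set.univ) ∧ (∀ t < 0, Literature.Analysis.FluidPDE.VectorCalculus.IsDivFree (u t)) ∧ (∀ s t : ℝ, s < t → t < 0 → ∀ x, u t x = Literature.Analysis.FluidPDE.heatFlow (u s) (t-s) x - ∫ τ in Set.Ioo s t, ∫ y, ((-(inner ℝ (x-y) (u τ y) / (2*(t-τ)) * Literature.Analysis.UnboundedOperators.heatKernel (t-τ) (x-y))) • u τ y + (∫ σ in Set.Ioi (t-τ), Literature.Analysis.UnboundedOperators.heatKernel σ (x-y) / (4*σ^2)) • (inner ℝ (x-y) (u τ y) • u τ y + inner ℝ (u τ y) (u τ y) • (x-y) + inner ℝ (x-y) (u τ y) • u τ y) - ((∫ σ in Set.Ioi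 (t-τ), Literature.Analysis.UnboundedOperators.heatKernel σ (x-y) / (8*σ^3)) * (inner ℝ (x-y) (u τ y) * inner ℝ (x-y) (u τ y))) • (x-y))) ∧ Literature.Analysis.FluidPDE.HasTypeITimeDecay C u ∧ (∀ (x₀ : EuclideanSpace ℝ (Fin 3)) (t₀ r : ℝ), t₀ ≤ 0 → 0 < r → (∀ t, t₀ - r^2 < t → t < t₀ → r⁻¹ * ∫ x in Metric.ball x₀ r, ‖u t x‖^2 ≤ C) ∧ r⁻¹ * ∫ t in Set.Ioo (t₀ - r^2) t₀, ∫ x in Metric.ball x₀ r, ‖fderiv ℝ (u t) x‖^2 ≤ C)) → m ≤ Literature.Analysis.FluidPDE.lerayMiddleStrain u t₀ x₀ → False) := by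
  rw [← not_and_or]
  exact ⟨fun hn hp => not_stubPair_of_not_squeezeLiouville hn hp,
    fun hn hX => hn (stubPair_of_squeezeLiouville hX)⟩

/-! ### What the production currency and the cubic margin buy: the value `1/4` -/

/-- **Under the crux, given the Λ-family `hMS` (VERBATIM the hypothesis of
`extremalBiaxialitySubcritical_bootstrap`): `stub_largeExcessExclusion` holds and no element of any
class takes the value `Λ = 1/4` anywhere.** [folklore] -/
theorem largeExcess_and_ne_quarter_of_crux
    (hMS : ∀ a : ℝ, a < 1 / 4 → ∀ (C : ℝ) (u : ℝ → EuclideanSpace ℝ (Fin 3) → EuclideanSpace ℝ (Fin 3)), ContDiffOn ℝ (⊤ : ℕ∞) (Function.uncurry u) (Set.Iio 0 ×ˢ Set.univ) ∧ (∀ t < 0, Literature.Analysis.FluidPDE.VectorCalculus.IsDivFree (u t)) ∧ (∀ s t : ℝ, s < t → t < 0 → ∀ x, u t x = Literature.Analysis.FluidPDE.heatFlow (u s) (t-s) x - ∫ τ in Set.Ioo s t, ∫ y, ((-(inner ℝ (x-y) (u τ y) / (2*(t-τ)) * Literature.Analysis.UnboundedOperators.heatKernel (t-τ) (x-y))) •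 u τ y + (∫ σ in Set.Ioi (t-τ), Literature.Analysis.UnboundedOperators.heatKernel σ (x-y) / (4*σ^2)) • (inner ℝ (x-y) (u τ y) • u τ y + inner ℝ (u τ y) (u τ y) • (x-y) + inner ℝ (x-y) (u τ y) • u τ y) - ((∫ σ in Set.Ioi (t-τ), Literature.Analysis.UnboundedOperators.heatKernel σ (x-y) / (8*σ^3)) * (inner ℝ (x-y) (u τ y) * inner ℝ (x-y) (u τ y))) • (x-y))) ∧ Literature.Analysis.FluidPDE.HasTypeITimeDecay C u ∧ (∀ (x₀ : EuclideanSpace ℝ (Fin 3)) (t₀ r : ℝ), t₀ ≤ 0 → 0 < r → (∀ t, t₀ - r^2 < t → t < t₀ → r⁻¹ * ∫ x in Metric.ball x₀ r, ‖u t x‖^2 ≤ C) ∧ r⁻¹ * ∫ t in Set.Ioo (t₀ - r^2) t₀, ∫ x in Metric.ball x₀ r, ‖fderiv ℝ (u t) x‖^2 ≤ C) → (∀ t < 0, ∀ x, (∃ v w : EuclideanSpace ℝ (Fin 3), ‖v‖ = 1 ∧ ‖w‖ = 1 ∧ inner ℝ v w = 0 ∧ ∀ α β : ℝ, (-t) *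 inner ℝ (fderiv ℝ (u t) x (α • v + β • w)) (α • v + β • w) ≤ a * (α^2 + β^2))) → ∀ t < 0, ∀ x, u t x = 0)
    (hX : SqueezeCycle.ExtremalBiaxialitySubcritical) :
    (∀ (C K m : ℝ) (u : ℝ → EuclideanSpace ℝ (Fin 3) → EuclideanSpace ℝ (Fin 3)) (t₀ : ℝ) (x₀ : EuclideanSpace ℝ (Fin 3)), 0 < K → (∀ (v' : ℝ → EuclideanSpace ℝ (Fin 3) → EuclideanSpace ℝ (Fin 3)), ContDiffOn ℝ (⊤ : ℕ∞) (Function.uncurry v') (Set.Iio 0 ×ˢ Set.univ) ∧ (∀ t < 0, Literature.Analysis.FluidPDE.VectorCalculus.IsDivFree (v' t)) ∧ (∀ s t : ℝ, s < t → t < 0 → ∀ x, v' t x = Literature.Analysis.FluidPDE.heatFlow (v' s) (t-s) x - ∫ τ in Set.Ioo s t, ∫ y, ((-(inner ℝ (x-y) (v' τ y) / (2*(t-τ)) * Literature.Analysis.UnboundedOperators.heatKernel (t-τ) (x-y))) • v' τ y + (∫ σ in Set.Ioi (t-τ), Literature.Analysis.UnboundedOperators.heatKernel σ (x-y) / (4*σ^2))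 • (inner ℝ (x-y) (v' τ y) • v' τ y + inner ℝ (v' τ y) (v' τ y) • (x-y) + inner ℝ (x-y) (v' τ y) • v' τ y) - ((∫ σ in Set.Ioi (t-τ), Literature.Analysis.UnboundedOperators.heatKernel σ (x-y) / (8*σ^3)) * (inner ℝ (x-y) (v' τ y) * inner ℝ (x-y) (v' τ y))) • (x-y))) ∧ Literature.Analysis.FluidPDE.HasTypeITimeDecay C v' ∧ (∀ (x₀ : EuclideanSpace ℝ (Fin 3)) (t₀ r : ℝ), t₀ ≤ 0 → 0 < r → (∀ t, t₀ - r^2 < t → t < t₀ → r⁻¹ * ∫ x in Metric.ball x₀ r, ‖v' t x‖^2 ≤ C) ∧ r⁻¹ * ∫ t in Set.Ioo (t₀ - r^2) t₀, ∫ x in Metric.ball x₀ r, ‖fderiv ℝ (v' t) x‖^2 ≤ C) → ∀ t < 0, ∀ x, (∑ i, ∑ j, (((1 / 2 : ℝ) • (Literature.Analysis.FluidPDE.stdMatrix (fderiv ℝ (v' t) x : EuclideanSpace ℝ (Fin 3) →ₗ[ℝ] EuclideanSpace ℝ (Fin 3)) + (Literature.Analysis.FluidPDE.stdMatrix (fderiv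 ℝ (v' t) x : EuclideanSpace ℝ (Fin 3) →ₗ[ℝ] EuclideanSpace ℝ (Fin 3)))ᵀ)) i j) ^ 2) ≤ (K / (-t)) ^ 2 ∧ Literature.Analysis.FluidPDE.lerayMiddleStrain v' t x ≤ m) → 0 ≤ m → 1 / 4 ≤ m - 2 * m ^ 3 / K ^ 2 → t₀ < 0 → (ContDiffOn ℝ (⊤ : ℕ∞) (Function.uncurry u) (Set.Iio 0 ×ˢ Set.univ) ∧ (∀ t < 0, Literature.Analysis.FluidPDE.VectorCalculus.IsDivFree (u t)) ∧ (∀ s t : ℝ, s < t → t < 0 → ∀ x, u t x = Literature.Analysis.FluidPDE.heatFlow (u s) (t-s) x - ∫ τ in Set.Ioo s t, ∫ y, ((-(inner ℝ (x-y) (u τ y) / (2*(t-τ)) * Literature.Analysis.UnboundedOperators.heatKernel (t-τ) (x-y))) • u τ y + (∫ σ in Set.Ioi (t-τ), Literature.Analysis.UnboundedOperators.heatKernel σ (x-y) / (4*σ^2)) • (inner ℝ (x-y) (u τ y) • u τ y + inner ℝ (u τ y) (u τ y) • (x-y) + inner ℝ (x-y) (u τ y) • u τ y) - ((∫ σ in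 Set.Ioi (t-τ), Literature.Analysis.UnboundedOperators.heatKernel σ (x-y) / (8*σ^3)) * (inner ℝ (x-y) (u τ y) * inner ℝ (x-y) (u τ y))) • (x-y))) ∧ Literature.Analysis.FluidPDE.HasTypeITimeDecay C u ∧ (∀ (x₀ : EuclideanSpace ℝ (Fin 3)) (t₀ r : ℝ), t₀ ≤ 0 → 0 < r → (∀ t, t₀ - r^2 < t → t < t₀ → r⁻¹ * ∫ x in Metric.ball x₀ r, ‖u t x‖^2 ≤ C) ∧ r⁻¹ * ∫ t in Set.Ioo (t₀ - r^2) t₀, ∫ x in Metric.ball x₀ r, ‖fderiv ℝ (u t) x‖^2 ≤ C)) → m ≤ Literature.Analysis.FluidPDE.lerayMiddleStrain u t₀ x₀ → False) ∧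
      ∀ (C : ℝ) (u : ℝ → EuclideanSpace ℝ (Fin 3) → EuclideanSpace ℝ (Fin 3)), (ContDiffOn ℝ (⊤ : ℕ∞) (Function.uncurry u) (Set.Iio 0 ×ˢ Set.univ) ∧ (∀ t < 0, Literature.Analysis.FluidPDE.VectorCalculus.IsDivFree (u t)) ∧ (∀ s t : ℝ, s < t → t < 0 → ∀ x, u t x = Literature.Analysis.FluidPDE.heatFlow (u s) (t-s) x - ∫ τ in Set.Ioo s t, ∫ y, ((-(inner ℝ (x-y) (u τ y) / (2*(t-τ)) * Literature.Analysis.UnboundedOperators.heatKernel (t-τ) (x-y))) • u τ y + (∫ σ in Set.Ioi (t-τ), Literature.Analysis.UnboundedOperators.heatKernel σ (x-y) / (4*σ^2)) • (inner ℝ (x-y) (u τ y) • u τ y + inner ℝ (u τ y) (u τ y) • (x-y) + inner ℝ (x-y) (u τ y) • u τ y) - ((∫ σ in Set.Ioi (t-τ), Literature.Analysis.UnboundedOperators.heatKernel σ (x-y) / (8*σ^3)) * (inner ℝ (x-y) (u τ y) * inner ℝ (x-y) (u τ y))) • (x-y))) ∧ Literature.Analysis.FluidPDE.HasTypeITimeDecay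 C u ∧ (∀ (x₀ : EuclideanSpace ℝ (Fin 3)) (t₀ r : ℝ), t₀ ≤ 0 → 0 < r → (∀ t, t₀ - r^2 < t → t < t₀ → r⁻¹ * ∫ x in Metric.ball x₀ r, ‖u t x‖^2 ≤ C) ∧ r⁻¹ * ∫ t in Set.Ioo (t₀ - r^2) t₀, ∫ x in Metric.ball x₀ r, ‖fderiv ℝ (u t) x‖^2 ≤ C)) →
        ∀ t < 0, ∀ x, lerayMiddleStrain u t x ≠ 1 / 4 := by
  have h := (crux_iff_forall_lerayMiddleStrain_lt_quarter hMS).1 hX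
  exact ⟨largeExcess_of_crux hX, fun C u hu t ht x => (h C u hu t ht x).ne⟩

/-- **Kill shape of the crux relative to the large-excess stub**, given only the Λ-family (e.g. from the
leaky stub via `msFamily_of_leakyNonneg`): the crux fails iff `stub_largeExcessExclusion` (VERBATIM)
fails or SOME element of SOME `𝒦_C` has `Λ = 1/4` at SOME point `t < 0` — the single value that the
production currency of the leaky law and the cubic refinement `b = m − 2m³/K²` dispose of. [folklore] -/
theorem not_crux_iff_of_msFamily
    (hMS : ∀ a : ℝ, a < 1 / 4 → ∀ (C : ℝ) (u : ℝ → EuclideanSpace ℝ (Fin 3) → EuclideanSpace ℝ (Fin 3)), ContDiffOn ℝ (⊤ : ℕ∞) (Function.uncurry u) (Set.Iio 0 ×ˢ Set.univ) ∧ (∀ t < 0, Literature.Analysis.FluidPDE.VectorCalculus.IsDivFree (u t)) ∧ (∀ s t : ℝ, s < t → t < 0 → ∀ x, u t x = Literature.Analysis.FluidPDE.heatFlow (u s) (t-s) x - ∫ τ in Set.Ioo s t, ∫ y, ((-(inner ℝ (x-y) (u τ y) / (2*(t-τ)) * Literature.Analysis.UnboundedOperators.heatKernel (t-τ) (x-y)))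 • u τ y + (∫ σ in Set.Ioi (t-τ), Literature.Analysis.UnboundedOperators.heatKernel σ (x-y) / (4*σ^2)) • (inner ℝ (x-y) (u τ y) • u τ y + inner ℝ (u τ y) (u τ y) • (x-y) + inner ℝ (x-y) (u τ y) • u τ y) - ((∫ σ in Set.Ioi (t-τ), Literature.Analysis.UnboundedOperators.heatKernel σ (x-y) / (8*σ^3)) * (inner ℝ (x-y) (u τ y) * inner ℝ (x-y) (u τ y))) • (x-y))) ∧ Literature.Analysis.FluidPDE.HasTypeITimeDecay C u ∧ (∀ (x₀ : EuclideanSpace ℝ (Fin 3)) (t₀ r : ℝ), t₀ ≤ 0 → 0 < r → (∀ t, t₀ - r^2 < t → t < t₀ → r⁻¹ * ∫ x in Metric.ball x₀ r, ‖u t x‖^2 ≤ C) ∧ r⁻¹ * ∫ t in Set.Ioo (t₀ - r^2) t₀, ∫ x in Metric.ball x₀ r, ‖fderiv ℝ (u t) x‖^2 ≤ C) → (∀ t < 0, ∀ x, (∃ v w : EuclideanSpace ℝ (Fin 3), ‖v‖ = 1 ∧ ‖w‖ = 1 ∧ inner ℝ v w = 0 ∧ ∀ α β : ℝ, (-t)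 * inner ℝ (fderiv ℝ (u t) x (α • v + β • w)) (α • v + β • w) ≤ a * (α^2 + β^2))) → ∀ t < 0, ∀ x, u t x = 0) :
    ¬ SqueezeCycle.ExtremalBiaxialitySubcritical ↔
      ¬ (∀ (C K m : ℝ) (u : ℝ → EuclideanSpace ℝ (Fin 3) → EuclideanSpace ℝ (Fin 3)) (t₀ : ℝ) (x₀ : EuclideanSpace ℝ (Fin 3)), 0 < K → (∀ (v' : ℝ → EuclideanSpace ℝ (Fin 3) → EuclideanSpace ℝ (Fin 3)), ContDiffOn ℝ (⊤ : ℕ∞) (Function.uncurry v') (Set.Iio 0 ×ˢ Set.univ) ∧ (∀ t < 0, Literature.Analysis.FluidPDE.VectorCalculus.IsDivFree (v' t)) ∧ (∀ s t : ℝ, s < t → t < 0 → ∀ x, v' t x = Literature.Analysis.FluidPDE.heatFlow (v' s) (t-s) x - ∫ τ in Set.Ioo s t, ∫ y, ((-(inner ℝ (x-y) (v' τ y) / (2*(t-τ)) * Literature.Analysis.UnboundedOperators.heatKernel (t-τ) (x-y))) • v' τ y + (∫ σ in Set.Ioi (t-τ), Literature.Analysis.UnboundedOperators.heatKernel σ (x-y)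 / (4*σ^2)) • (inner ℝ (x-y) (v' τ y) • v' τ y + inner ℝ (v' τ y) (v' τ y) • (x-y) + inner ℝ (x-y) (v' τ y) • v' τ y) - ((∫ σ in Set.Ioi (t-τ), Literature.Analysis.UnboundedOperators.heatKernel σ (x-y) / (8*σ^3)) * (inner ℝ (x-y) (v' τ y) * inner ℝ (x-y) (v' τ y))) • (x-y))) ∧ Literature.Analysis.FluidPDE.HasTypeITimeDecay C v' ∧ (∀ (x₀ : EuclideanSpace ℝ (Fin 3)) (t₀ r : ℝ), t₀ ≤ 0 → 0 < r → (∀ t, t₀ - r^2 < t → t < t₀ → r⁻¹ * ∫ x in Metric.ball x₀ r, ‖v' t x‖^2 ≤ C) ∧ r⁻¹ * ∫ t in Set.Ioo (t₀ - r^2) t₀, ∫ x in Metric.ball x₀ r, ‖fderiv ℝ (v' t) x‖^2 ≤ C) → ∀ t < 0, ∀ x, (∑ i, ∑ j, (((1 / 2 : ℝ) • (Literature.Analysis.FluidPDE.stdMatrix (fderiv ℝ (v' t) x : EuclideanSpace ℝ (Fin 3) →ₗ[ℝ] EuclideanSpace ℝ (Fin 3)) + (Literature.Analysis.FluidPDE.stdMatrix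 (fderiv ℝ (v' t) x : EuclideanSpace ℝ (Fin 3) →ₗ[ℝ] EuclideanSpace ℝ (Fin 3)))ᵀ)) i j) ^ 2) ≤ (K / (-t)) ^ 2 ∧ Literature.Analysis.FluidPDE.lerayMiddleStrain v' t x ≤ m) → 0 ≤ m → 1 / 4 ≤ m - 2 * m ^ 3 / K ^ 2 → t₀ < 0 → (ContDiffOn ℝ (⊤ : ℕ∞) (Function.uncurry u) (Set.Iio 0 ×ˢ Set.univ) ∧ (∀ t < 0, Literature.Analysis.FluidPDE.VectorCalculus.IsDivFree (u t)) ∧ (∀ s t : ℝ, s < t → t < 0 → ∀ x, u t x = Literature.Analysis.FluidPDE.heatFlow (u s) (t-s) x - ∫ τ in Set.Ioo s t, ∫ y, ((-(inner ℝ (x-y) (u τ y) / (2*(t-τ)) * Literature.Analysis.UnboundedOperators.heatKernel (t-τ) (x-y))) • u τ y + (∫ σ in Set.Ioi (t-τ), Literature.Analysis.UnboundedOperators.heatKernel σ (x-y) / (4*σ^2)) • (inner ℝ (x-y) (u τ y) • u τ y + inner ℝ (u τ y) (u τ y) • (x-y) + inner ℝ (x-y) (u τ y) • u τ y) - ((∫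 σ in Set.Ioi (t-τ), Literature.Analysis.UnboundedOperators.heatKernel σ (x-y) / (8*σ^3)) * (inner ℝ (x-y) (u τ y) * inner ℝ (x-y) (u τ y))) • (x-y))) ∧ Literature.Analysis.FluidPDE.HasTypeITimeDecay C u ∧ (∀ (x₀ : EuclideanSpace ℝ (Fin 3)) (t₀ r : ℝ), t₀ ≤ 0 → 0 < r → (∀ t, t₀ - r^2 < t → t < t₀ → r⁻¹ * ∫ x in Metric.ball x₀ r, ‖u t x‖^2 ≤ C) ∧ r⁻¹ * ∫ t in Set.Ioo (t₀ - r^2) t₀, ∫ x in Metric.ball x₀ r, ‖fderiv ℝ (u t) x‖^2 ≤ C)) → m ≤ Literature.Analysis.FluidPDE.lerayMiddleStrain u t₀ x₀ → False) ∨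
        ∃ (C : ℝ) (u : ℝ → EuclideanSpace ℝ (Fin 3) → EuclideanSpace ℝ (Fin 3)) (t : ℝ) (x : EuclideanSpace ℝ (Fin 3)),
          t < 0 ∧ (ContDiffOn ℝ (⊤ : ℕ∞) (Function.uncurry u) (Set.Iio 0 ×ˢ Set.univ) ∧ (∀ t < 0, Literature.Analysis.FluidPDE.VectorCalculus.IsDivFree (u t)) ∧ (∀ s t : ℝ, s < t → t < 0 → ∀ x, u t x = Literature.Analysis.FluidPDE.heatFlow (u s) (t-s) x - ∫ τ in Set.Ioo s t, ∫ y, ((-(inner ℝ (x-y) (u τ y) / (2*(t-τ)) * Literature.Analysis.UnboundedOperators.heatKernel (t-τ) (x-y))) • u τ y + (∫ σ in Set.Ioi (t-τ), Literature.Analysis.UnboundedOperators.heatKernel σ (x-y) / (4*σ^2)) • (inner ℝ (x-y) (u τ y) • u τ y + inner ℝ (u τ y) (u τ y) • (x-y) + inner ℝ (x-y) (u τ y) • u τ y) - ((∫ σ in Set.Ioi (t-τ), Literature.Analysis.UnboundedOperators.heatKernel σ (x-y) / (8*σ^3)) * (inner ℝ (x-y) (u τ y) * inner ℝ (x-y)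 (u τ y))) • (x-y))) ∧ Literature.Analysis.FluidPDE.HasTypeITimeDecay C u ∧ (∀ (x₀ : EuclideanSpace ℝ (Fin 3)) (t₀ r : ℝ), t₀ ≤ 0 → 0 < r → (∀ t, t₀ - r^2 < t → t < t₀ → r⁻¹ * ∫ x in Metric.ball x₀ r, ‖u t x‖^2 ≤ C) ∧ r⁻¹ * ∫ t in Set.Ioo (t₀ - r^2) t₀, ∫ x in Metric.ball x₀ r, ‖fderiv ℝ (u t) x‖^2 ≤ C)) ∧ lerayMiddleStrain u t x = 1 / 4 := by
  constructor
  · intro hn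
    by_contra hc
    push Not at hc
    obtain ⟨hE, hne⟩ := hc
    apply hn
    rw [crux_iff_forall_lerayMiddleStrain_lt_quarter hMS]
    intro C u hu t ht x
    exact lt_of_le_of_ne (largeExcess_iff_forall_le_quarter.1 hE C u hu t ht x) (hne C u t x ht hu)
  · rintro (hE | ⟨C, u, t, x, ht, hu, heq⟩) hX
    · exact hE (largeExcess_of_crux hX)
    · exact (largeExcess_and_ne_quarter_of_crux hMS hX).2 C u hu t ht x heq

end Summit.NavierStokesRegularity.NavierStokesRegularity.Theorems.ExtremalBiaxialitySubcritical.Negative.QuarterBootstrap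

end
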